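import Literature.MathematicalPhysics.QuantumFieldTheory.Balaban1983to89.B15Claim189CubePin
import Literature.MathematicalPhysics.QuantumFieldTheory.Balaban1983to89.B14SeparationOfRecord

/-!
# `Balaban1983to89.B15Claim189LambdaPin` — YM-DAG node N12 · [Balaban1989LargeFieldI] CMP **122** (1989) 175–202, (1.73) p. 192 with p. 200 (first display) and p. 179:
# THE LETTER `Λ` OF THE (1.89) SITUATION PINNED — `Λ = (Ω^{∼4}_{k₀+1})ᶜ ∩ Z` over node00-def-T's layer algebra `hullD` of the `𝐃_{k₀+1}`-cubes of record — and THE LAST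
# LOCATED-GEOMETRY INPUT OF THE (1.89) DISPLAY, the shell bound of p. 200, DISCHARGED in the form the assembly reads it (`4M ≤ dist(p, Λ)` on the shells `Ω_m∖Ω_{m+1}`, `k₀ < m < k`)

statement-level bookkeeping over published theorems with citation tags; kernel-checked compositions of tree theorems; nothing here is a claim about the Yang–Mills
mass gap.

CITATION HEADER (lean-in-tree rule).  Source: [Balaban1989LargeFieldI] («[IV]»; page images `…-p018-x2.png`, `…-p026-x2.png`, `…-p005-x2.png` re-read by this seat), verbatim:
p. 192, (1.73): *"The new large field region Z″_k is given by (1.10), i.e., Z″_k = (Ω^{∼5}_{k₀+1})ᶜ ∩ Z, hence it is a union of M-cubes, by the definition of the index k₀, and it is a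
rectangular parallelepiped. Define Λ = (Ω^{∼4}_{k₀+1})ᶜ ∩ Z. (1.73) This domain, obtained by adding one layer of M-cubes to Z″_k, is also a union of M-cubes"*; p. 179: *"the domains
Ω_j^{∼n} are unions of L^{−(k−j)}MR_j-cubes of the lattice T_η. Take the smallest positive integer N₀ such, that L^{−N₀+1}MR_{k−N₀+1} = M"*; p. 200, first display: *"Consider Ω_m∖Ω_{m+1}
for k₀ < m < k. We have j = k, and the exponential can be bounded by exp(−δ(L^{−(k−m)}8MR_m + ⋯ + L^{−(k−k₀−2)}8MR_{k₀+2} + L^{−(k−k₀−1)}4MR_{k₀+1})) ≦ exp(−4δ(m − k₀)M), hence the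
last term in the bound (1.98) can be made arbitrarily small for M large enough"*; (1.80) p. 195 (*«exp(−δ dist(p, Λ))»*).  [Balaban1988Convergent] («[III]») (2.1) p. 254, (2.5)–(2.6)
p. 255, p. 264–265 (the layer calculus *«surrounded by n layers»*); [Balaban1987RG1] (0.1) p. 251 (the torus), (0.20) p. 256; [Balaban1985Averaging] (5) p. 18 (plaquette corners).
Seat `pub-ymgap-dag-n12-e` (YM-PLAN Track A, HUMAN RULING D-0062; director-ym R134 row N12 s3 «the (1.80)∕(1.89) + 𝐑′ (1.99)–(1.100) p. 201 chain»), generation 6, module 16 (v1 p506077; v1.1 §9–§10).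
BY NAME and UNCHANGED: node00-def-T's `Node00.hullD`, `Node00.sideD` (`StepWeightsOfRecord` §1–§2), def-R's `cubeEnl`, `cubeIndices`, `dCubeSide`, `RkOfRecord`, `isRj_RkOfRecord`,
r12's `B14DomainGeom` (`Pt`, `cubeIdx`), `B14.Eq213MaximalDomains.cubeExt`, `B15Eq112TorusCover` (`cover`, `lift`), `B8Eq17ClassAkV1.plaqsOf`, `Setup`'s `Site.tdist`, p29's
`B15Claim189Assembly` (`Setting189`, `claim189_assembly` through module 11's `claim189_assembly_trunc`), r12's `B15Claim189Cases.lastTerm_le`, modules 4 (`Node00.Sit189`), 5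
(`hscale_of_flow_bdd`, window lemmas), 11 (`omegaOfChain`, `X_le_of_levels`, `claim189_assembly_trunc`, `hjEqK_of_nested`), 12 (`N0OfSeq` + API, `RkOfRecord_anti`,
`genSeq_le_succ_of_beta_nonneg`), dag-n11-e's `B14SeparationOfRecord.one_le_RkOfRecord`, 13 (`zppOfChain`, `Sit189.pinZpp`, `zppOfChain_hZk`), 14 (`D189OfHist`, `sitOfHist`, `pinLevels_*`, `N0OfRecord₁₃`, the window lemmas), 15
(`cubeOfSite`, `Sit189.pinCubes ∕ pinDistAt`, `distToSet`, `distOfRecord`, `hbox_sitOfHist_pinCubes`, `hdist_pinDistAt`), Mathlib's `ZMod.valMinAbs`.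

WHY THIS FILE.  After modules 13 (`hZk`) and 15 (`hbox`, `hdist`) the ONE located-geometry input of the (1.89) display still DISPLAYED was the shell bound
`hgeom : 4(m − k₀)M ≤ dist(p, Λ)` on `Ω_m∖Ω_{m+1}`, `k₀ < m < k` (p. 200, first display) — over the residual letter `Λ` of the situation.  Two facts close it:
(1) print DEFINES `Λ` ((1.73) above): the complement inside `Z` of `Ω_{k₀+1}` surrounded by FOUR layers of `𝐃_{k₀+1}`-cubes (side `L^{−(k−k₀−1)}MR_{k₀+1}` = `M` by the
`N₀`-equation — *«M-cubes»*); this enlargement is node00-def-T's `hullD P s 4` at the side `L^{k₀+1}·M·R_{k₀+1}` of record (`StepWeightsOfRecord` §1–§2; the same calculus builds the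
(3.2)∕(3.5) regions of record).  (2) the assembly consumes `hgeom` ONLY through p29's `hlast_of_largeM` (p. 200 *«arbitrarily small for M large enough»*), which reads
`4(m − k₀)M ≤ dist` via `m − k₀ ≥ 1`, i.e. through `4M ≤ dist(p, Λ)` — EXACTLY the last term `L^{−(k−k₀−1)}·4M·R_{k₀+1}` of print's displayed sum: the four layers between `Ω_{k₀+1}
⊇ Ω_m` and `Λ`.  So the shell bound AS USED is a lattice theorem at the `Λ`-pin — NO separation law of the (2.1)-chain is needed for (1.89) (the shell terms `L^{−(k−n)}8MR_n`, i.e. the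
separations of [III] p. 256 ∕ dag-n11-e's `B14SeparationOfRecord`, only strengthen an already sufficient bound; director-ym LINE №136's load-bearing separation concerns the bg-row).
The one delicate point is the lattice unit: `plaqsOf` takes plaquettes TOUCHING a region and `dist` is measured from the source corner; a naive `ℓ¹` argument loses two fine steps.
It is recovered coordinatewise: outside four cube layers SOME coordinate's cyclic distance is `≥ 4s + 1`, and a corner moves each coordinate of the source by at most `1` (§1).

* §1 TORUS LATTICE (generic `P : Params`): `coordDist` (the summand of `Site.tdist`; `= |valMinAbs|`), `exists_lift_near` (a lift within the coordinate cyclic distances),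
  `mem_cubeEnl_cubeOfSite_of_near`, `mem_hullD_of_near`, ★ `exists_lt_coordDist_of_not_mem_hullD`, `coordDist_le_succ_of_coord`, `corner_coord`, ★ `mul_le_tdist_src_of_not_mem_hullD`
  (`n·s ≤ tdist(p.src, y)` for `p` touching `X`, `y ∉ hullD s n X`), `le_distToSet_of_forall`, ★ `mul_le_distToSet_of_subset_compl`, `hullD_mono_layers`, `subset_hullD`.
* §2 THE ENLARGEMENT OF RECORD `enlD F ν M P g n j S := hullD (F.P P.K) (L^j·M·R_j) n S` (print's `Ω_j^{∼n}`; the CONCRETE instance of module 13's letter `enl`): `enlD_succ_eq_hullD_sideD`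
  (`rfl` with def-T's `sideD`), ★ `subset_enlD` (INFLATIONARY for `0 < M` — modules 13∕14∕15's `henl` DISCHARGED), `enlD_mono_layers`.
* §3 THE `N₀`-EQUATION for module 12's `N₀`: `pow_le_RkOfRecord_N0OfSeq` (`L^{N₀−1} ≤ R_{k+1−N₀}` under ONE STEP of monotone couplings), ★ `RkOfRecord_eq_pow_N0OfSeq`
  (`R_{k+1−N₀} = L^{N₀−1}` — print's EQUATION p. 179∕192, for the `N₀` module 12 read as the least solution of the inequality; referee ref-I READ-86's located note answered),
  `mul_pow_le_dCubeSide` (the `𝐃_{k₀+1}`-cubes have side `≥ M·L^k` fine sites: they ARE the «M-cubes»).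
* §4 THE PIN **`Node00.Sit189.pinLambda σ s N₀ enl`** (`Λ := (enl 4 (k′+1−N₀) Ω_{k′+1−N₀})ᶜ ∩ Z`) + faces (`pinLambda_Λ`, `_Λ_subset`, `_kept`, `_comm` with the term ∕ levels ∕ cubes ∕ `Z″`
  pins; ORDER: before the χ′ ∕ distance ∕ `dev0` pins, which read `Λ` — `pinLambda_then_readers`), `zppOfChain_top_subset_pinLambda` (`Λ ⊇ Z″_k`, (1.73)∕(1.10)).
* §5 ★★ **`hcollar_sitOfHist_pinLambda`** — at the term's fully pinned situation over `enlD` (Λ, then module 15's distance, module 13's `Z″`, module 15's cubes): ON EVERY SHELL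
  `Ω_m∖Ω_{m+1}`, `k₀ < m < k`, EVERY PLAQUETTE TOUCHING IT HAS `4·M ≤ dist(p, Λ)` (k-units), from `Λ ≠ ∅`, `1 ≤ N₀ ≤ k′` and `L^{N₀−1} ≤ R_{k′+1−N₀}`; `hR_of_monotone_step`.
* §6 `claim189_assembly_printed_of_collar` (module 11's `claim189_assembly_printed_of_flow` VERBATIM with `hgeom` weakened to `hcollar : 4M ≤ dist`, via `lastTerm_le` at `g = 1`),
  `hcollar_of_hgeom` (the printed form implies the used one), `claim189_sitOfHist_of_collar` (module 14's `claim189_sitOfHist_of_flow` likewise), ★★★ **`claim189_sitOfHist_Λ_of_flow`** and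
  **`claim189_sitOfHist_Λ_of_inInterval`** — THE (1.89) DISPLAY WITH EVERY LOCATED-GEOMETRY INPUT DISCHARGED (`hZk`, `hbox`, `hdist`, `hgeom`) and `henl` too; `coupling_step_of_inInterval`.
* §7 ★★★ **`claim189_sitOfHist₁₃_Λ_of_inInterval`** — the same at the Stage-13 tokens (`gOfRecord₁₃`, `betaOfRecord₁₃`, `N0OfRecord₁₃`, `θ.τ9.M`), module 14 §7's shape.
* §8 CENSUS (A2): `pinLambda_dist_eq_zero_of_subset` (`Z ⊆ Ω^{∼4}_{k₀+1}` ⇒ `Λ = ∅`, pinned distance `0`: the side condition `Λ ≠ ∅` is load-bearing), `enlD_of_M_eq_zero` (`M = 0` ⇒ the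
  enlargement of record is `∅`, not inflationary: `0 < M` is load-bearing).
* §9 (v1.1, append-only; §1–§8 byte-identical to v1 p506077) THE `Λ`-PINNED RESIDUAL LAYER **`Node00.ResidW.pinD189ΛH`** (module 14 §5's `pinD189TH` at the full pin stack per run,
  `N₀(P)` the `N₀` of the history) + `rfl` faces (`pinD189ΛH_D189 ∕ _faces ∕ _dist`) and dag-n12-d's `h189` SLOT SUPPLIED WITH NO LOCATED-GEOMETRY BINDER:
  ★★ `h189_pinD189ΛH_of_h180_of_flow` (window-free) and ★★ `h189_pinD189ΛH₁₃_of_h180_of_inInterval` (Record-13 tokens, module 14 §7's shape).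
* §10 (v1.1) `joint_edge_of_hwin_of_N0OfSeq_le` — print's *«N has to be sufficiently large»* (p. 198) in numbers: the threshold `hwin` and the memory bound `N₀ ≤ N` jointly force
  `4(2 + C) ≤ (L₀²)^{N−1}` (referee ref-I READ-86 NIT-I1 on module 12, in kernel).

INPUTS OF THE (1.89) DISPLAY AFTER THIS FILE (at `claim189_sitOfHist₁₃_Λ_of_inInterval`): THEOREMS — levels, (2.1) nesting, `α`, `hX′∕hsmall` (print's first condition from ONE
threshold `hwin`), `hjEqK∕hZk`, `hbox`, `hdist`, `hgeom` (as used), `henl`, the flow inputs, the coupling step; DISPLAYED — per-run memory `N ≥ N₀(P)` and scope `N₀(P) ≤ k′`, residual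
numerics `0 ≤ β ≤ 1/4`, `2 ≤ L₀`, `L₀² ≤ L`, signs `0 ≤ O(1)B₃B₅`, `0 ≤ δ`, `0 < σ.sh`, `0 < M`, print's second condition `hMl` («M large»), the window data (`S`, `hI`, `hup`, `hβhist`,
`hε10`, `hA₀`, `r ≥ 1`), `Λ ≠ ∅`, the four ℍ-leaves (1.90)∕(1.94)∕p. 199 and (1.80) ([B11]-at-objects, node N07), and — outside this display — Prop. 1 and the masses (other lanes).

LOCATED (nothing asserted): (i) print's `Ω_j^{∼n}` enlarges a union of partition cubes by `n` layers; `hullD P s n X` = the cubes whose `n`-collar meets `X` — the same set when `X` is a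
union of `s`-cubes (print's standing convention), the layer-enlargement of the cube hull `X̃` otherwise (LARGER, so `Λ` only SMALLER and the display's `dist(·, Λ)` only larger: the
collar bound is unaffected, it needs `Λ ∩ Ω^{∼4} = ∅` only); (ii) of p. 200's displayed sum only its LAST TERM is used by the tree's assembly (p29 `hlast_of_largeM`, module 11); the typed
`hgeom` with the factor `(m − k₀)` remains what module 14∕15's `_of_flow` displays ask, and is NOT derived here (it needs the separations `L^{−(k−n)}8MR_n` of the chain; the record's
construction gives three `𝐃`-layers per step, `B14SeparationOfRecord`, print writes `8`); `hcollar_of_hgeom` records that the printed form implies the used one; (iii) `Λ ≠ ∅` ⟺ `Z ⊄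
Ω^{∼4}_{k₀+1}`: in print `Λ ⊇ Z″_k ⊇ Z″_{h+1} ⊇ (Ω″^{∼2}_{h+1})ᶜ` (p. 195) is non-empty in every term on which the 𝐑-operation acts; the component union `Z` is a (1.99) summation variable
(residual), so the condition is displayed per term; (iv) the `N₀`-equation needs one step of non-decreasing couplings in `]0, 1]` at the levels `k₀ + 1, k₀ + 2` — [I] Thm 2's input
`β ≥ 0`, the DAG leaf `betaPositive` along a `genFlow` world (module 12 §6), displayed as `hβhist` in the window forms.

HONEST FRAMING.  Count-neutral: one data transformer, finite torus geometry and the arithmetic of (2.5)∕p. 179; NO estimate of Bałaban's asserted; N12 NOT discharged; one finite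
four-torus programme at fixed `ε`, Bałaban AS PRINTED with locators; nothing continuum ∕ ℝ⁴ ∕ OS ∕ mass gap ∕ Clay.  No `sorry`, no `axiom`, no `instance`, no `notation`.
-/

noncomputable section

open scoped BigOperators

namespace Literature.MathematicalPhysics.QuantumFieldTheory.Balaban1983to89

namespace B15Claim189LambdaPin

open DagBinding T4Continuum Node00
open B14DomainGeom (Pt cubeIdx cubeIdx_le)
open B14.Eq213MaximalDomains (cubeExt)
open B15Eq112TorusCover (cover lift cover_lift)
open B8Eq17ClassAkV1 (plaqsOf)
open B15Claim189CubePin (cubeOfSite cubeOfSite_mem_cubeIndices mem_cubeEnl_cubeOfSite mem_cubeExt_cubeIdx_of_near lift_lt_mul_cubeIdx_add distToSet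
  distToSet_le_of_mem distOfRecord distOfRecord_nonneg)

/-! ## §1. Torus lattice geometry: coordinate cyclic distances, nearest lifts, cube layers, plaquette corners -/

section Lattice

variable {P : Params}

/-- The cyclic distance of the `i`-th coordinates of two fine-torus sites — the `i`-th summand of `Site.tdist` (`ℓ¹` torus distance in fine steps).
[cite: Balaban1987RG1, (0.1) p.251 (the torus; bookkeeping)] -/
def coordDist (x y : Site P 0) (i : Fin P.d) : ℕ := min (x i - y i).val (y i - x i).val

/-- `Site.tdist` is the sum of the coordinate cyclic distances (`rfl`). [cite: Balaban1987RG1, (0.1) p.251 (bookkeeping)] -/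
theorem tdist_eq_sum_coordDist (x y : Site P 0) : Site.tdist x y = ∑ i, coordDist x y i := rfl

/-- One coordinate's cyclic distance is at most the `ℓ¹` torus distance. [cite: Balaban1987RG1, (0.1) p.251 (bookkeeping)] -/
theorem coordDist_le_tdist (x y : Site P 0) (i : Fin P.d) : coordDist x y i ≤ Site.tdist x y :=
  Finset.single_le_sum (f := fun j => coordDist x y j) (fun _ _ => Nat.zero_le _) (Finset.mem_univ i)

/-- The coordinate cyclic distance is the absolute value of Mathlib's balanced residue `valMinAbs` of the coordinate difference. [cite: Balaban1987RG1, (0.1) p.251 (the torus; bookkeeping)] -/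
theorem coordDist_eq_natAbs (x y : Site P 0) (i : Fin P.d) : coordDist x y i = (x i - y i).valMinAbs.natAbs := by
  rw [ZMod.valMinAbs_natAbs_eq_min]
  unfold coordDist
  rw [show y i - x i = -(x i - y i) by ring, ZMod.neg_val]
  split_ifs with h
  · simp [h]
  · rfl

/-- `coordDist x x i = 0`. [cite: Balaban1987RG1, (0.1) p.251 (the torus; bookkeeping)] -/
theorem coordDist_self (x : Site P 0) (i : Fin P.d) : coordDist x x i = 0 := by
  simp [coordDist]

/-- **THE NEAREST LIFT**: a point of the universal cover over `x` whose `i`-th coordinate is within the `i`-th cyclic distance `coordDist x y i` of the standard lift of `y`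
(shift the standard lift of `y` by the balanced residues of `x − y`). [cite: Balaban1987RG1, (0.1) p.251 (the torus; bookkeeping)] -/
theorem exists_lift_near (x y : Site P 0) :
    ∃ z : Pt P.d, cover P z = x ∧ ∀ i, lift P y i - coordDist x y i ≤ z i ∧ z i ≤ lift P y i + coordDist x y i := by
  refine ⟨fun i => lift P y i + (x i - y i).valMinAbs, ?_, fun i => ?_⟩
  · funext i
    simp only [cover, lift, Int.cast_add, Int.cast_natCast, ZMod.natCast_zmod_val, ZMod.coe_valMinAbs, add_sub_cancel]
  · rw [coordDist_eq_natAbs, Int.natCast_natAbs]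
    constructor
    · simp only; linarith [neg_abs_le (x i - y i).valMinAbs]
    · simp only; linarith [le_abs_self (x i - y i).valMinAbs]

/-- A site coordinatewise within `n·s` of `y` lies in the `n`-layer enlargement of the `s`-cube of `y`. [cite: Balaban1988Convergent, (2.16)–(2.17) p.257, p.265 («surrounded by n layers»)] -/
theorem mem_cubeEnl_cubeOfSite_of_near {s n : ℕ} (hs : 0 < s) {x y : Site P 0} (h : ∀ i, coordDist x y i ≤ n * s) :
    x ∈ cubeEnl P s (cubeOfSite s y) n := by
  obtain ⟨z, hzx, hz⟩ := exists_lift_near x y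
  refine ⟨z, mem_cubeExt_cubeIdx_of_near s hs (lift P y) z (w := ((n * s : ℕ) : ℤ)) (fun i => ⟨?_, ?_⟩), hzx⟩
  · have h1 := (hz i).1
    have h2 : ((coordDist x y i : ℕ) : ℤ) ≤ ((n * s : ℕ) : ℤ) := by exact_mod_cast h i
    linarith
  · have h1 := (hz i).2
    have h2 : ((coordDist x y i : ℕ) : ℤ) ≤ ((n * s : ℕ) : ℤ) := by exact_mod_cast h i
    linarith

/-- **LAYER MEMBERSHIP FROM COORDINATE DISTANCES**: if `c ∈ X` is coordinatewise within `n·s` of `y`, then `y ∈ hullD P s n X` (the `n`-collar of the cube of `y` meets `X` at `c`).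
[cite: Balaban1988Convergent, p.264–265 («the union of all … cubes intersecting», «surrounded by n layers»)] -/
theorem mem_hullD_of_near {s n : ℕ} (hs : 0 < s) {X : Set (Site P 0)} {c y : Site P 0} (hc : c ∈ X) (h : ∀ i, coordDist c y i ≤ n * s) :
    y ∈ hullD P s n X := by
  classical
  unfold hullD
  refine Set.mem_iUnion₂.2 ⟨cubeOfSite s y, Finset.mem_filter.2 ⟨cubeOfSite_mem_cubeIndices s hs y, c, mem_cubeEnl_cubeOfSite_of_near hs h, hc⟩, ?_⟩
  exact mem_cubeEnl_cubeOfSite s hs y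

/-- **OUTSIDE `n` LAYERS, SOME COORDINATE IS FAR**: for `y ∉ hullD P s n X` and `c ∈ X`, some coordinate's cyclic distance exceeds `n·s` (so is `≥ n·s + 1`).
[cite: Balaban1988Convergent, p.264–265; Balaban1989LargeFieldI, (1.73) p.192 («adding one layer of M-cubes»)] -/
theorem exists_lt_coordDist_of_not_mem_hullD {s n : ℕ} (hs : 0 < s) {X : Set (Site P 0)} {c y : Site P 0} (hc : c ∈ X) (hy : y ∉ hullD P s n X) :
    ∃ i, n * s < coordDist c y i := by
  by_contra h
  push Not at h
  exact hy (mem_hullD_of_near hs hc h)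

/-- The fine torus has at least two sites per direction (`2L^{m+K}`), so `(1 : ℤ∕Nℤ)` has balanced residue of absolute value `≤ 1`. [cite: Balaban1987RG1, (0.1) p.251 (bookkeeping)] -/
theorem natAbs_valMinAbs_one_le_one : ((1 : ZMod (P.sitesPerDir 0)).valMinAbs).natAbs ≤ 1 := by
  have h2 : 1 ≤ P.sitesPerDir 0 / 2 := by
    unfold Params.sitesPerDir
    have h1 : 1 ≤ P.L ^ (P.m + P.K - 0) := Nat.one_le_pow _ _ P.L_pos
    omega
  have h : ((1 : ℕ) : ZMod (P.sitesPerDir 0)).valMinAbs = (1 : ℕ) := ZMod.valMinAbs_natCast_of_le_half h2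
  rw [Nat.cast_one] at h
  rw [h]
  rfl

/-- **ONE LATTICE STEP MOVES A COORDINATE CYCLIC DISTANCE BY AT MOST ONE**: if `c i = x i` or `c i = x i + 1` then `coordDist c y i ≤ coordDist x y i + 1`.
[cite: Balaban1985Averaging, (5) p.18 (plaquette corners; bookkeeping)] -/
theorem coordDist_le_succ_of_coord (x c y : Site P 0) (i : Fin P.d) (h : c i = x i ∨ c i = x i + 1) : coordDist c y i ≤ coordDist x y i + 1 := by
  rcases h with h | h
  · unfold coordDist; rw [h]; exact Nat.le_succ _
  · rw [coordDist_eq_natAbs, coordDist_eq_natAbs, h, show x i + 1 - y i = (x i - y i) + 1 by ring]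
    calc ((x i - y i) + 1).valMinAbs.natAbs ≤ ((x i - y i).valMinAbs + (1 : ZMod (P.sitesPerDir 0)).valMinAbs).natAbs := ZMod.natAbs_valMinAbs_add_le _ _
      _ ≤ (x i - y i).valMinAbs.natAbs + ((1 : ZMod (P.sitesPerDir 0)).valMinAbs).natAbs := Int.natAbs_add_le _ _
      _ ≤ (x i - y i).valMinAbs.natAbs + 1 := Nat.add_le_add_left natAbs_valMinAbs_one_le_one _

/-- Coordinates of a shifted site: `(x + e_μ) i` is `x i + 1` for `i = μ` and `x i` otherwise. [cite: Balaban1985Averaging, (5) p.18 (bookkeeping)] -/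
theorem shift_apply (x : Site P 0) (μ i : Fin P.d) : (x.shift μ) i = if i = μ then x i + 1 else x i := by
  unfold Site.shift
  by_cases h : i = μ
  · subst h; simp
  · simp [h]

/-- **A CORNER OF A PLAQUETTE MOVES EACH COORDINATE OF THE SOURCE BY `0` OR `1`** (the two unit steps are in the distinct directions `μ < ν`).
[cite: Balaban1985Averaging, (5) p.18 (plaquette convention)] -/
theorem corner_coord (p : Plaq P 0) {c : Site P 0} (hc : c = p.src ∨ c = p.src.shift p.μ ∨ c = p.src.shift p.ν ∨ c = (p.src.shift p.μ).shift p.ν) (i : Fin P.d) :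
    c i = p.src i ∨ c i = p.src i + 1 := by
  have hne : p.μ ≠ p.ν := ne_of_lt p.hμν
  rcases hc with rfl | rfl | rfl | rfl
  · exact Or.inl rfl
  · rw [shift_apply]; split_ifs <;> simp
  · rw [shift_apply]; split_ifs <;> simp
  · simp only [shift_apply]
    by_cases hν : i = p.ν
    · right; rw [if_pos hν, if_neg (fun hμ => hne (hμ.symm.trans hν))]
    · rw [if_neg hν]
      by_cases hμ : i = p.μ
      · right; rw [if_pos hμ]
      · left; rw [if_neg hμ]

/-- ★ **FOUR CUBE LAYERS GIVE FOUR SIDE LENGTHS — EXACTLY, FOR EVERY PLAQUETTE TOUCHING THE REGION**: if `p` touches `X` (a corner in `X`, `plaqsOf`) and `y ∉ hullD P s n X` (`0 < s`),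
then `n·s ≤ tdist(p.src, y)`: the far coordinate of the corner is `≥ n·s + 1` away and the source differs from the corner by at most `1` in that coordinate.
[cite: Balaban1989LargeFieldI, (1.73) p.192, p.200 (first display, last term «L^{−(k−k₀−1)}4MR_{k₀+1}»); Balaban1988Convergent, p.264–265] -/
theorem mul_le_tdist_src_of_not_mem_hullD {s n : ℕ} (hs : 0 < s) {X : Set (Site P 0)} {p : Plaq P 0} (hp : p ∈ plaqsOf X) {y : Site P 0}
    (hy : y ∉ hullD P s n X) : n * s ≤ Site.tdist p.src y := by
  obtain ⟨c, hcX, hc⟩ : ∃ c ∈ X, c = p.src ∨ c = p.src.shift p.μ ∨ c = p.src.shift p.ν ∨ c = (p.src.shift p.μ).shift p.ν := by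
    rw [B8Eq17ClassAkV1.mem_plaqsOf] at hp
    rcases hp with h | h | h | h
    · exact ⟨_, h, Or.inl rfl⟩
    · exact ⟨_, h, Or.inr (Or.inl rfl)⟩
    · exact ⟨_, h, Or.inr (Or.inr (Or.inl rfl))⟩
    · exact ⟨_, h, Or.inr (Or.inr (Or.inr rfl))⟩
  obtain ⟨i, hi⟩ := exists_lt_coordDist_of_not_mem_hullD hs hcX hy
  have h1 := coordDist_le_succ_of_coord p.src c y i (corner_coord p hc i)
  have h2 := coordDist_le_tdist p.src y i
  omega

/-- A uniform lower bound on the distances to the points of a NONEMPTY set bounds the distance to the set (`distToSet` = the attained infimum). [cite: Balaban1989LargeFieldI, (1.80) p.195 («dist(p, Λ)»; bookkeeping)] -/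
theorem le_distToSet_of_forall {Λ : Set (Site P 0)} (hΛ : Λ.Nonempty) {x : Site P 0} {w : ℕ} (h : ∀ y ∈ Λ, w ≤ Site.tdist x y) : w ≤ distToSet Λ x := by
  have hne : (Site.tdist x '' Λ).Nonempty := hΛ.image _
  obtain ⟨y, hy, hyeq⟩ := Nat.sInf_mem hne
  show w ≤ sInf (Site.tdist x '' Λ)
  rw [← hyeq]
  exact h y hy

/-- ★ **THE COLLAR BOUND FOR `dist(·, Λ)`**: if `Λ` is nonempty and avoids `hullD P s n X`, every plaquette touching `X` has `n·s ≤ dist_{ℓ¹}(p.src, Λ)` (fine steps).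
[cite: Balaban1989LargeFieldI, (1.73) p.192, (1.80) p.195, p.200 (first display)] -/
theorem mul_le_distToSet_of_subset_compl {s n : ℕ} (hs : 0 < s) {X Λ : Set (Site P 0)} (hΛ : Λ.Nonempty) (hsub : Λ ⊆ (hullD P s n X)ᶜ) {p : Plaq P 0}
    (hp : p ∈ plaqsOf X) : n * s ≤ distToSet Λ p.src :=
  le_distToSet_of_forall hΛ fun _ hy => mul_le_tdist_src_of_not_mem_hullD hs hp (hsub hy)

/-- `hullD` is monotone in the number of layers. [cite: Balaban1988Convergent, p.265 (bookkeeping)] -/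
theorem hullD_mono_layers {s m n : ℕ} (hmn : m ≤ n) (X : Set (Site P 0)) : hullD P s m X ⊆ hullD P s n X := by
  classical
  intro y hy
  unfold hullD at hy ⊢
  obtain ⟨a, ha, hya⟩ := Set.mem_iUnion₂.1 hy
  obtain ⟨haI, z, hzm, hzX⟩ := Finset.mem_filter.1 ha
  refine Set.mem_iUnion₂.2 ⟨a, Finset.mem_filter.2 ⟨haI, z, ?_, hzX⟩, hya⟩
  obtain ⟨u, hu, rfl⟩ := hzm
  refine ⟨u, fun i => ⟨?_, ?_⟩, rfl⟩
  · have h1 := (hu i).1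
    have h2 : ((m * s : ℕ) : ℤ) ≤ ((n * s : ℕ) : ℤ) := by exact_mod_cast Nat.mul_le_mul_right s hmn
    linarith
  · have h1 := (hu i).2
    have h2 : ((m * s : ℕ) : ℤ) ≤ ((n * s : ℕ) : ℤ) := by exact_mod_cast Nat.mul_le_mul_right s hmn
    linarith

/-- A region lies inside each of its layer enlargements (`0 < s`). [cite: Balaban1988Convergent, p.265 (bookkeeping)] -/
theorem subset_hullD {s : ℕ} (hs : 0 < s) (n : ℕ) (X : Set (Site P 0)) : X ⊆ hullD P s n X :=
  fun x hx => mem_hullD_of_near hs hx fun i => by rw [coordDist_self]; exact Nat.zero_le _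

end Lattice

/-! ## §2. The concrete enlargement of record: print's `Ω_j^{∼n}` by `n` layers of `L^{−(k−j)}MR_j`-cubes of `T_η` = def-T's `hullD` over the `𝐃_j`-cubes -/

section Enlargement

variable (F : T4Family) (ν : Stage7Numerics) (M : ℕ) (P : B12.RunParams) (g : ℕ → ℝ)

/-- **THE ENLARGEMENT OF RECORD** `enlD n j S := S` surrounded by `n` layers of `𝐃_j`-cubes (side `L^j·M·R_j` fine sites, `R_j = RkOfRecord L r g_j` of (2.5)) — print p. 179: *«the domains
Ω_j^{∼n} are unions of L^{−(k−j)}MR_j-cubes of the lattice T_η»*; the CONCRETE instance of module 13's enlargement letter `enl`. [cite: Balaban1989LargeFieldI, p.179, (1.73) p.192; Balaban1988Convergent, (2.1) p.254, p.264–265] -/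
def enlD : ℕ → ℕ → Set (Site (F.P P.K) 0) → Set (Site (F.P P.K) 0) :=
  fun n j S => hullD (F.P P.K) (dCubeSide (F.P P.K).L M (RkOfRecord (F.P P.K).L ν.r (g j)) j) n S

variable {F ν M P g}

/-- Unfolding (`rfl`). [cite: Balaban1989LargeFieldI, p.179 (bookkeeping)] -/
theorem enlD_apply (n j : ℕ) (S : Set (Site (F.P P.K) 0)) :
    enlD F ν M P g n j S = hullD (F.P P.K) (dCubeSide (F.P P.K).L M (RkOfRecord (F.P P.K).L ν.r (g j)) j) n S := rfl

/-- At level `j + 1` the side is def-T's `sideD … j` (`rfl`): `enlD n (j+1) S = hullD (sideD F ν M P g j) n S`. [cite: Balaban1988Convergent, (2.1) p.254, p.264 (bookkeeping)] -/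
theorem enlD_succ_eq_hullD_sideD (n j : ℕ) (S : Set (Site (F.P P.K) 0)) : enlD F ν M P g n (j + 1) S = hullD (F.P P.K) (sideD F ν M P g j) n S := rfl

/-- The `𝐃_j`-cube side of record is positive for `0 < M`. [cite: Balaban1988Convergent, (2.1) p.254 (bookkeeping)] -/
theorem dCubeSide_pos (hM : 0 < M) (j : ℕ) : 0 < dCubeSide (F.P P.K).L M (RkOfRecord (F.P P.K).L ν.r (g j)) j := by
  unfold dCubeSide
  have hL : 1 ≤ (F.P P.K).L := (F.P P.K).L_pos
  exact Nat.mul_pos (Nat.mul_pos (Nat.pow_pos (F.P P.K).L_pos) hM) (B14SeparationOfRecord.one_le_RkOfRecord hL _ _)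

/-- **THE ENLARGEMENT OF RECORD IS INFLATIONARY** (`0 < M`): `S ⊆ enlD n j S` — module 13's ∕ 14's ∕ 15's displayed input `henl`, DISCHARGED. [cite: Balaban1989LargeFieldI, p.179; Balaban1988Convergent, p.265] -/
theorem subset_enlD (hM : 0 < M) : ∀ n j (S : Set (Site (F.P P.K) 0)), S ⊆ enlD F ν M P g n j S :=
  fun n j S => subset_hullD (dCubeSide_pos hM j) n S

/-- The enlargement of record is monotone in the number of layers: `Ω^{∼m} ⊆ Ω^{∼n}` for `m ≤ n`. [cite: Balaban1989LargeFieldI, (1.73) p.192 («adding one layer»)] -/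
theorem enlD_mono_layers {m n : ℕ} (hmn : m ≤ n) (j : ℕ) (S : Set (Site (F.P P.K) 0)) : enlD F ν M P g m j S ⊆ enlD F ν M P g n j S :=
  hullD_mono_layers hmn S

end Enlargement

/-! ## §3. The `N₀`-EQUATION for the `N₀` of record: `R_{k+1−N₀} = L^{N₀−1}` — the `𝐃_{k₀+1}`-cubes ARE print's «M-cubes» of the k-th unit lattice -/

section N0Equation

open B15Claim189N0OfRecord (N0OfSeq N0OfSeq_spec lt_RkOfRecord_of_lt_N0OfSeq RkOfRecord_anti)

variable {L : ℕ} (r : ℕ) (g : ℕ → ℝ) (k : ℕ)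

/-- **`L^{N₀−1} ≤ R_{k+1−N₀}`** — the lower half of print's equation *«L^{−N₀+1}MR_{k−N₀+1} = M»* (p. 179) for module 12's `N₀` (least `n ≥ 1` with `R(g_{k+1−n}) ≤ L^{n−1}`): for `N₀ = 1`
from `R ≥ 1`; for `N₀ ≥ 2` from minimality at `N₀ − 1` (`L^{N₀−2} < R(g_{k+2−N₀})`), ONE STEP of monotone couplings (`0 < g_{k+1−N₀} ≤ g_{k+2−N₀} ≤ 1`, so `R` does not increase,
[III] (2.5)–(2.6)) and `R` being a power of `L`. [cite: Balaban1989LargeFieldI, p.179, p.192 («L^{N₀−1} = R_{k−N₀+1}»), p.200; Balaban1988Convergent, (2.5)–(2.6) p.255] -/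
theorem pow_le_RkOfRecord_N0OfSeq (hL : 2 ≤ L) (hpos : 0 < g (k + 1 - N0OfSeq L r g k)) (hstep : g (k + 1 - N0OfSeq L r g k) ≤ g (k + 2 - N0OfSeq L r g k))
    (hle : g (k + 2 - N0OfSeq L r g k) ≤ 1) : L ^ (N0OfSeq L r g k - 1) ≤ RkOfRecord L r (g (k + 1 - N0OfSeq L r g k)) := by
  obtain ⟨h1, -⟩ := N0OfSeq_spec r g k hL
  obtain ⟨t, ht, -, -⟩ := isRj_RkOfRecord hL r (g (k + 1 - N0OfSeq L r g k))
  by_cases h2 : N0OfSeq L r g k = 1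
  · rw [ht, h2]
    exact Nat.pow_le_pow_right (by omega) (Nat.zero_le _)
  · have hN2 : 2 ≤ N0OfSeq L r g k := by omega
    have hlt := lt_RkOfRecord_of_lt_N0OfSeq r g k hL (n := N0OfSeq L r g k - 1) (by omega) (by omega)
    rw [show k + 1 - (N0OfSeq L r g k - 1) = k + 2 - N0OfSeq L r g k by omega, show N0OfSeq L r g k - 1 - 1 = N0OfSeq L r g k - 2 by omega] at hlt
    have hanti := RkOfRecord_anti hL r hpos hstep hle
    have hlt' : L ^ (N0OfSeq L r g k - 2) < L ^ t := by rw [← ht]; exact lt_of_lt_of_le hlt hanti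
    have hexp : N0OfSeq L r g k - 2 < t := (Nat.pow_lt_pow_iff_right (by omega)).1 hlt'
    rw [ht]
    exact Nat.pow_le_pow_right (by omega) (by omega)

/-- ★ **PRINT'S EQUATION FOR THE `N₀` OF RECORD**: `R_{k+1−N₀} = L^{N₀−1}` (module 12 read print's equation at its first solution as an inequality; under one step of monotone couplings
it IS the equation — answering referee ref-I's located note on module 12). [cite: Balaban1989LargeFieldI, p.179 («L^{−N₀+1}MR_{k−N₀+1} = M»), p.192, p.200; Balaban1988Convergent, (2.5)–(2.6) p.255] -/
theorem RkOfRecord_eq_pow_N0OfSeq (hL : 2 ≤ L) (hpos : 0 < g (k + 1 - N0OfSeq L r g k)) (hstep : g (k + 1 - N0OfSeq L r g k) ≤ g (k + 2 - N0OfSeq L r g k))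
    (hle : g (k + 2 - N0OfSeq L r g k) ≤ 1) : RkOfRecord L r (g (k + 1 - N0OfSeq L r g k)) = L ^ (N0OfSeq L r g k - 1) :=
  le_antisymm (N0OfSeq_spec r g k hL).2 (pow_le_RkOfRecord_N0OfSeq r g k hL hpos hstep hle)

/-- ★ **THE `𝐃_{k₀+1}`-CUBES ARE PRINT'S M-CUBES**: with `N₀ ≤ k + 1` and `L^{N₀−1} ≤ R_{k+1−N₀}`, the fine side `L^{k+1−N₀}·M·R_{k+1−N₀}` of the `𝐃_{k+1−N₀}`-cubes is `≥ M·L^k`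
(= with the equation): p. 192 *«Λ … is also a union of M-cubes»*, p. 179 *«Z″_k … is a union of M-cubes, by the definition of the index k₀»*. [cite: Balaban1989LargeFieldI, p.179, (1.73) p.192] -/
theorem mul_pow_le_dCubeSide {M N₀ : ℕ} {Rk : ℕ} (hN1 : 1 ≤ N₀) (hNk : N₀ ≤ k + 1) (hR : L ^ (N₀ - 1) ≤ Rk) :
    M * L ^ k ≤ dCubeSide L M Rk (k + 1 - N₀) := by
  unfold dCubeSide
  have hk : L ^ k = L ^ (k + 1 - N₀) * L ^ (N₀ - 1) := by rw [← pow_add]; congr 1; omega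
  calc M * L ^ k = L ^ (k + 1 - N₀) * M * L ^ (N₀ - 1) := by rw [hk]; ring
    _ ≤ L ^ (k + 1 - N₀) * M * Rk := Nat.mul_le_mul_left _ hR

end N0Equation

/-! ## §4. THE PIN: `Λ := (Ω^{∼4}_{k₀+1})ᶜ ∩ Z` ((1.73)) -/

section Pin

open B15Claim189PrintedConditions (omegaOfChain omegaOfChain_succ_subset)
open B15Claim189ZppPin (zppOfChain zppOfChain_top)
open B15Ineq180PinAtRecord (dev0OfRecord)

variable {F : T4Family} {N : ℕ} [NeZero N]

/-- **THE (1.89) SITUATION WITH ITS LETTER `Λ` PINNED** ((1.73) p. 192, verbatim: *«Define Λ = (Ω^{∼4}_{k₀+1})ᶜ ∩ Z. This domain, obtained by adding one layer of M-cubes to Z″_k, is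
also a union of M-cubes»*): `Λ := (enl 4 (k′+1−N₀) (Ω_{k′+1−N₀}))ᶜ ∩ Z` — the term's chain `s` (clamped, module 11's `omegaOfChain`), the number `N₀` (`k₀ + 1 = k′ + 1 − N₀`), an
enlargement `enl` (print's `∼4`; the enlargement of record `enlD` below, or a letter), the situation's own component union `Z`.  ORDER: before module 15's distance pin and module 8's
`dev0` pin (which read `Λ`); independent of the term ∕ levels ∕ cubes ∕ `Z″` ∕ χ′ pins.  Data, no law. [cite: Balaban1989LargeFieldI, (1.73) p.192, (1.89) p.198] -/
def _root_.Literature.MathematicalPhysics.QuantumFieldTheory.Balaban1983to89.Node00.Sit189.pinLambda {K : ℕ} (σ : Sit189 F N K)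
    {D : ℕ → Set (Set (Site (F.P K) 0))} {k' : ℕ} (s : B14.Eq218Concrete.Seq D k') (N₀ : ℕ) (enl : ℕ → ℕ → Set (Site (F.P K) 0) → Set (Site (F.P K) 0)) : Sit189 F N K :=
  { σ with Λ := (enl 4 (k' + 1 - N₀) (omegaOfChain s (k' + 1 - N₀)))ᶜ ∩ σ.Z }

variable {K : ℕ} (σ : Sit189 F N K) {D : ℕ → Set (Set (Site (F.P K) 0))} {k' : ℕ} (s : B14.Eq218Concrete.Seq D k') (N₀ : ℕ)
  (enl : ℕ → ℕ → Set (Site (F.P K) 0) → Set (Site (F.P K) 0))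

/-- The pinned letter (`rfl`). [cite: Balaban1989LargeFieldI, (1.73) p.192 (bookkeeping)] -/
theorem pinLambda_Λ : (σ.pinLambda s N₀ enl).Λ = (enl 4 (k' + 1 - N₀) (omegaOfChain s (k' + 1 - N₀)))ᶜ ∩ σ.Z := rfl

/-- `Λ ⊆ Z` and `Λ` avoids `Ω^{∼4}_{k₀+1}`. [cite: Balaban1989LargeFieldI, (1.73) p.192] -/
theorem pinLambda_Λ_subset : (σ.pinLambda s N₀ enl).Λ ⊆ σ.Z ∧ (σ.pinLambda s N₀ enl).Λ ⊆ (enl 4 (k' + 1 - N₀) (omegaOfChain s (k' + 1 - N₀)))ᶜ :=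
  ⟨Set.inter_subset_right, Set.inter_subset_left⟩

/-- The pin keeps every other field (`rfl`; `HEq` for the chart letter). [cite: Balaban1989LargeFieldI, (1.89) p.198 (bookkeeping)] -/
theorem pinLambda_kept : (σ.pinLambda s N₀ enl).𝔤 = σ.𝔤 ∧ HEq (σ.pinLambda s N₀ enl).chiP σ.chiP ∧ (σ.pinLambda s N₀ enl).h = σ.h ∧ (σ.pinLambda s N₀ enl).k₀ = σ.k₀ ∧
    (σ.pinLambda s N₀ enl).k = σ.k ∧ (σ.pinLambda s N₀ enl).sh = σ.sh ∧ (σ.pinLambda s N₀ enl).sk = σ.sk ∧ (σ.pinLambda s N₀ enl).Ω = σ.Ω ∧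
    (σ.pinLambda s N₀ enl).Zpp = σ.Zpp ∧ (σ.pinLambda s N₀ enl).Z = σ.Z ∧ (σ.pinLambda s N₀ enl).OmT = σ.OmT ∧ (σ.pinLambda s N₀ enl).ΩppT2 = σ.ΩppT2 ∧
    (σ.pinLambda s N₀ enl).β = σ.β ∧ (σ.pinLambda s N₀ enl).L₀ = σ.L₀ ∧ (σ.pinLambda s N₀ enl).α = σ.α ∧ (σ.pinLambda s N₀ enl).δ = σ.δ ∧ (σ.pinLambda s N₀ enl).B₃ = σ.B₃ ∧
    (σ.pinLambda s N₀ enl).B₅ = σ.B₅ ∧ (σ.pinLambda s N₀ enl).M = σ.M ∧ (σ.pinLambda s N₀ enl).O1 = σ.O1 ∧ (σ.pinLambda s N₀ enl).dist = σ.dist ∧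
    (σ.pinLambda s N₀ enl).Xhalf = σ.Xhalf ∧ (σ.pinLambda s N₀ enl).XH = σ.XH ∧ (σ.pinLambda s N₀ enl).XΩ4 = σ.XΩ4 ∧ (σ.pinLambda s N₀ enl).boxOf = σ.boxOf ∧
    (σ.pinLambda s N₀ enl).dev0 = σ.dev0 ∧ (σ.pinLambda s N₀ enl).devV'' = σ.devV'' ∧ (σ.pinLambda s N₀ enl).dev97 = σ.dev97 :=
  ⟨rfl, HEq.rfl, rfl, rfl, rfl, rfl, rfl, rfl, rfl, rfl, rfl, rfl, rfl, rfl, rfl, rfl, rfl, rfl, rfl, rfl, rfl, rfl, rfl, rfl, rfl, rfl, rfl, rfl⟩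

/-- The `Λ`-pin commutes with the term, levels, cubes and `Z″` pins (`rfl`: disjoint fields; it reads only `Z` and its parameters) — NOT with module 7's χ′-pin, module 15's distance pin
and module 8's `dev0` pin, which READ `Λ` and come AFTER it. [cite: Balaban1989LargeFieldI, (1.89) p.198 (bookkeeping)] -/
theorem pinLambda_comm (M Nm N₀' N₀'' Nm' : ℕ) (S : Set (Site (F.P K) 0)) (enl' : ℕ → ℕ → Set (Site (F.P K) 0) → Set (Site (F.P K) 0)) :
    (σ.pinLambda s N₀ enl).pinTerm s = (σ.pinTerm s).pinLambda s N₀ enl ∧ (σ.pinLambda s N₀ enl).pinLevels M Nm N₀' = (σ.pinLevels M Nm N₀').pinLambda s N₀ enl ∧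
    (σ.pinLambda s N₀ enl).pinCubes S = (σ.pinCubes S).pinLambda s N₀ enl ∧ (σ.pinLambda s N₀ enl).pinZpp s N₀'' Nm' enl' = (σ.pinZpp s N₀'' Nm' enl').pinLambda s N₀ enl :=
  ⟨rfl, rfl, rfl, rfl⟩

/-- After the `Λ`-pin, module 15's distance letter and module 8's (1.80) deviation READ THE PINNED `Λ` (`rfl` ×2; so does module 7's χ′-pin, whose (1.82) bond family `𝔹₀` depends on `Λ`).
[cite: Balaban1989LargeFieldI, (1.80) p.195, (1.82) p.196 (bookkeeping)] -/
theorem pinLambda_then_readers (k : ℕ) (ν : Stage7Numerics) :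
    ((σ.pinLambda s N₀ enl).pinDistAt k).dist = distOfRecord ((enl 4 (k' + 1 - N₀) (omegaOfChain s (k' + 1 - N₀)))ᶜ ∩ σ.Z) k ∧
    ((σ.pinLambda s N₀ enl).pinDev0 ν).dev0 = dev0OfRecord F N ν K σ.Z ((enl 4 (k' + 1 - N₀) (omegaOfChain s (k' + 1 - N₀)))ᶜ ∩ σ.Z) σ.k := ⟨rfl, rfl⟩

/-- **`Λ ⊇ Z″_k`** ((1.73): *«obtained by adding one layer of M-cubes to Z″_k»*) at a common enlargement monotone in the number of layers: module 13's `Z″_k = (Ω^{∼5}_{k₀+1})ᶜ ∩ Z` lies in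
`Λ = (Ω^{∼4}_{k₀+1})ᶜ ∩ Z` (`2 ≤ N₀ ≤ N`). [cite: Balaban1989LargeFieldI, (1.73) p.192, (1.10) p.179] -/
theorem zppOfChain_top_subset_pinLambda (Nm : ℕ) (Zres : ℕ → Set (Site (F.P K) 0)) (hmono : ∀ j S, enl 4 j S ⊆ enl 5 j S) (hN2 : 2 ≤ N₀) (hNm : N₀ ≤ Nm) :
    zppOfChain s N₀ Nm σ.Z enl Zres k' ⊆ (σ.pinLambda s N₀ enl).Λ := by
  rw [zppOfChain_top s N₀ Nm σ.Z enl Zres hN2 hNm, pinLambda_Λ]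
  rintro x ⟨hx, hxZ⟩
  exact ⟨fun h => hx (hmono _ _ h), hxZ⟩

end Pin

/-! ## §5. ★ THE COLLAR BOUND `4M ≤ dist(p, Λ)` ON THE SHELLS — the assembly's reading of p. 200's first display — IS A THEOREM at the `Λ`-pinned, distance-pinned situation -/

section Collar

open B15Claim189Assembly (Setting189)
open B15Claim189PinsOfHistory (D189OfHist sitOfHist)
open B15Claim189PrintedConditions (omegaOfChain omegaOfChain_succ_subset)
open B15Claim189N0OfRecord (N0OfSeq N0OfSeq_spec)
open B15DeterminingSets (MSField)

variable {F : T4Family} {N : ℕ} [NeZero N] {ν : Stage7Numerics} {A₁ : ℝ} {M : ℕ} (Nm : ℕ) (P : B12.RunParams) (σ : Sit189 F N P.K) {g : ℕ → ℝ} {k' : ℕ}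
  (s : SeqOfRecord F ν M g P.K k') (N₀ p₁ : ℕ) (S : Set (Site (F.P P.K) 0))

/-- ★★ **THE SHELL BOUND IN THE FORM THE ASSEMBLY READS IT, AT THE PINNED LETTERS — A THEOREM.**  For the letters `D = D189OfHist ν P (sitOfHist … σ′ …) g` of the term's fully pinned situation
`σ′ = (((σ.pinLambda s N₀ enlD).pinDistAt k′).pinZpp s N₀ N enlD).pinCubes S` (Λ of (1.73) over the enlargement of record, then module 15's distance pin, module 13's `Z″`, module 15's cubes):
on every shell `Ω_m∖Ω_{m+1}`, `k₀ < m < k`, every plaquette `p` touching it has **`4·M ≤ dist(p, Λ)`** (k-block units), FROM: `Λ ≠ ∅` (a non-trivial 𝐑-step), `1 ≤ N₀ ≤ k′`, and the lower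
half `L^{N₀−1} ≤ R_{k′+1−N₀}` of the `N₀`-equation (§3).  Proof: `Ω_m ⊆ Ω_{k₀+1}` ((2.1) nesting), `Λ ⊆ (Ω^{∼4}_{k₀+1})ᶜ`, four `𝐃_{k₀+1}`-layers are `≥ 4·(L^{k₀+1}MR_{k₀+1}) ≥ 4M·L^{k′}` fine
steps away in one coordinate of a corner (§1), i.e. `≥ 4M` k-units at the source.  This is print's p. 200 display read through its LAST TERM `L^{−(k−k₀−1)}·4M·R_{k₀+1} = 4M` — the only
part of it the assembly uses (`B15Claim189Assembly.hlast_of_largeM` reads `4(m−k₀)M ≤ dist` via `m − k₀ ≥ 1`). [cite: Balaban1989LargeFieldI, p.200 (first display), (1.73) p.192, p.179; Balaban1988Convergent, (2.1) p.254, (2.5) p.255] -/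
theorem hcollar_sitOfHist_pinLambda
    {D : Setting189 (F.P P.K) (SU N) (MSField (F.P P.K) (SU N) × ((j : ℕ) → VecField (F.P P.K) j (EuclideanSpace ℝ (Fin (N ^ 2 - 1))))) (Pt (F.P P.K).d)}
    (hD : D = D189OfHist ν P (sitOfHist ν A₁ M Nm P ((((σ.pinLambda s N₀ (enlD F ν M P g)).pinDistAt k').pinZpp s N₀ Nm (enlD F ν M P g)).pinCubes S) g s N₀ p₁) g)
    (hΛ : ((enlD F ν M P g 4 (k' + 1 - N₀) (omegaOfChain s (k' + 1 - N₀)))ᶜ ∩ σ.Z).Nonempty) (hN1 : 1 ≤ N₀) (hNk : N₀ ≤ k')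
    (hR : (F.P P.K).L ^ (N₀ - 1) ≤ RkOfRecord (F.P P.K).L ν.r (g (k' + 1 - N₀))) :
    ∀ m, D.k₀ < m → m < D.k → ∀ p ∈ plaqsOf (D.Ω m \ D.Ω (m + 1)), 4 * D.M ≤ D.dist p := by
  subst hD
  intro m hm _ p hp
  change k' - N₀ < m at hm
  change p ∈ plaqsOf (omegaOfChain s m \ omegaOfChain s (m + 1)) at hp
  show 4 * (M : ℝ) ≤ (distToSet ((enlD F ν M P g 4 (k' + 1 - N₀) (omegaOfChain s (k' + 1 - N₀)))ᶜ ∩ σ.Z) p.src : ℝ) / ((F.P P.K).L : ℝ) ^ k'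
  have hLpos : (0 : ℝ) < ((F.P P.K).L : ℝ) ^ k' := by
    have := (F.P P.K).L_pos
    positivity
  rw [le_div_iff₀ hLpos]
  by_cases hM : M = 0
  · subst hM
    simp only [Nat.cast_zero, mul_zero, zero_mul]
    exact Nat.cast_nonneg _
  have hMpos : 0 < M := Nat.pos_of_ne_zero hM
  -- the plaquette touches `Ω_{k₀+1}`
  have hp' : p ∈ plaqsOf (omegaOfChain s (k' + 1 - N₀)) := by
    have hsub : omegaOfChain s m \ omegaOfChain s (m + 1) ⊆ omegaOfChain s (k' + 1 - N₀) :=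
      fun x hx => (antitone_nat_of_succ_le (omegaOfChain_succ_subset s)) (show k' + 1 - N₀ ≤ m by omega) hx.1
    rw [B8Eq17ClassAkV1.mem_plaqsOf] at hp ⊢
    rcases hp with h | h | h | h
    · exact Or.inl (hsub h)
    · exact Or.inr (Or.inl (hsub h))
    · exact Or.inr (Or.inr (Or.inl (hsub h)))
    · exact Or.inr (Or.inr (Or.inr (hsub h)))
  -- four layers of 𝐃_{k₀+1}-cubes in fine steps
  have hside := mul_pow_le_dCubeSide (L := (F.P P.K).L) (k := k') (M := M) hN1 (by omega) hR
  have hfine : 4 * dCubeSide (F.P P.K).L M (RkOfRecord (F.P P.K).L ν.r (g (k' + 1 - N₀))) (k' + 1 - N₀)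
      ≤ distToSet ((enlD F ν M P g 4 (k' + 1 - N₀) (omegaOfChain s (k' + 1 - N₀)))ᶜ ∩ σ.Z) p.src :=
    mul_le_distToSet_of_subset_compl (dCubeSide_pos (F := F) (ν := ν) (P := P) (g := g) hMpos _) hΛ Set.inter_subset_left hp'
  have hcast : (4 : ℝ) * (M : ℝ) * ((F.P P.K).L : ℝ) ^ k' ≤ ((4 * dCubeSide (F.P P.K).L M (RkOfRecord (F.P P.K).L ν.r (g (k' + 1 - N₀))) (k' + 1 - N₀) : ℕ) : ℝ) := by
    have h := Nat.mul_le_mul_left 4 hside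
    have h' : ((4 * (M * (F.P P.K).L ^ k') : ℕ) : ℝ) ≤ ((4 * dCubeSide (F.P P.K).L M (RkOfRecord (F.P P.K).L ν.r (g (k' + 1 - N₀))) (k' + 1 - N₀) : ℕ) : ℝ) := by
      exact_mod_cast h
    have e : ((4 * (M * (F.P P.K).L ^ k') : ℕ) : ℝ) = 4 * (M : ℝ) * ((F.P P.K).L : ℝ) ^ k' := by push_cast; ring
    linarith
  exact hcast.trans (by exact_mod_cast hfine)

/-- **THE `N₀`-EQUATION INPUT OF THE COLLAR BOUND FROM ONE STEP OF MONOTONE COUPLINGS** at `N₀ := N0OfSeq L r g k′` (§3): `0 < g_{k′+1−N₀} ≤ g_{k′+2−N₀} ≤ 1`.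
[cite: Balaban1989LargeFieldI, p.179, p.200; Balaban1988Convergent, (2.5)–(2.6) p.255] -/
theorem hR_of_monotone_step (hpos : 0 < g (k' + 1 - N0OfSeq (F.P P.K).L ν.r g k')) (hstep : g (k' + 1 - N0OfSeq (F.P P.K).L ν.r g k') ≤ g (k' + 2 - N0OfSeq (F.P P.K).L ν.r g k'))
    (hle : g (k' + 2 - N0OfSeq (F.P P.K).L ν.r g k') ≤ 1) :
    (F.P P.K).L ^ (N0OfSeq (F.P P.K).L ν.r g k' - 1) ≤ RkOfRecord (F.P P.K).L ν.r (g (k' + 1 - N0OfSeq (F.P P.K).L ν.r g k')) :=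
  pow_le_RkOfRecord_N0OfSeq ν.r g k' (B15Claim189N0OfRecord.two_le_L (F := F) P) hpos hstep hle

end Collar

/-! ## §6. The assembly reading the geometry through `4M ≤ dist` (module 11's printed-conditions form, `hgeom` weakened to what is used), and THE (1.89) DISPLAY WITH EVERY
## LOCATED-GEOMETRY INPUT DISCHARGED -/

section Generic

open B15.BasicStep (Claim189)
open B15.PrelimIntegrations (Ineq191 Ineq195)
open B15Chi124DetSets (E124)
open B15Claim189Assembly (Setting189 new189 chiPP X dom domK half)
open B15Claim189Cases (lastTerm_le)
open B15Claim189FlowAtRecord (hscale_of_flow_bdd)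
open B15Claim189PrintedConditions (X_le_of_levels claim189_assembly_trunc)
open GaugeGroup (dist1)
open GaugeField (plaqHol)

variable {P : Params} {G C ι : Type*} [GaugeGroup G]

/-- **(1.89), THE PROVED PART, WITH PRINT'S TWO CONDITIONS — THE SHELL GEOMETRY READ AS THE ASSEMBLY USES IT**: module 11's `claim189_assembly_printed_of_flow` VERBATIM except that the located
input `hgeom : 4(m − k₀)M ≤ dist(p, Λ)` is WEAKENED to `hcollar : 4M ≤ dist(p, Λ)` on the shells `Ω_m∖Ω_{m+1}`, `k₀ < m < k` — all that p. 200's *«hence the last term in the bound (1.98) can be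
made arbitrarily small for M large enough»* uses (r12's `lastTerm_le` at `g = 1`; module 11 ∕ p29 read `hgeom` through `m − k₀ ≥ 1` only).  `hgeom ⇒ hcollar` (`M ≥ 0`), so the printed form
is a corollary. [cite: Balaban1989LargeFieldI, (1.89) p.198, pp.199–200] -/
theorem claim189_assembly_printed_of_collar (D : Setting189 P G C ι) (hhk : D.h ≤ D.k₀) (hk : D.k₀ + 2 ≤ D.k)
    (hΩ : ∀ i, D.Ω (i + 1) ⊆ D.Ω i) (hΩtop : D.Ω D.k ⊆ D.Ω (D.k + 1))
    (hα : D.α = 1 / 12) (hβ0 : 0 ≤ D.β) (hβ : D.β ≤ 1 / 4) (hL₀ : 2 ≤ D.L₀) (hL₀L : D.L₀ ^ 2 ≤ D.L)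
    (hε0 : ∀ i, D.h ≤ i → i ≤ D.k → 0 ≤ D.ε i) (hε1 : ∀ i, D.h ≤ i → i ≤ D.k → D.ε i ≤ 1 / 10)
    (hB : 0 ≤ D.O1 * D.B₃ * D.B₅ * D.M ^ 5) (hδ : 0 ≤ D.δ) (hM : 0 ≤ D.M) (hdist : ∀ p, 0 ≤ D.dist p)
    -- p. 200: PRINT'S TWO CONDITIONS on N₀ = k − k₀ and on M
    (hN₀ : (2 + (121 / 120) ^ 2 * (D.O1 * D.B₃ * D.B₅ * D.M ^ 5)) * ((D.L₀ ^ 2) ^ (D.k - D.k₀ - 1))⁻¹ ≤ 1 / 4)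
    (hMlarge : (121 / 120) ^ 2 * (D.O1 * D.B₃ * D.B₅ * D.M ^ 5) * Real.exp (-(4 * D.δ * D.M)) ≤ D.α)
    -- p. 200: "We have j = k" and the shell geometry on Ω_m∖Ω_{m+1}, k₀ < m < k, IN THE FORM USED: the last term 4M of the displayed sum
    (hjEqK : ∀ m, D.k₀ < m → m < D.k → D.Ω m \ D.Ω (m + 1) ⊆ domK D)
    (hcollar : ∀ m, D.k₀ < m → m < D.k → ∀ p ∈ plaqsOf (D.Ω m \ D.Ω (m + 1)), 4 * D.M ≤ D.dist p)
    -- p. 199: the [III] flow relation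
    {β₀ : ℝ} (hβ₀0 : 0 ≤ β₀) (hβ₀ : β₀ ≤ 1 / 2)
    (hflow : ∀ j, D.h ≤ j → j < D.k → D.ε D.k ≤ (1 + β₀) * Real.sqrt ((D.k - j : ℕ) : ℝ) * D.ε j)
    -- (1.88): the cube cover of the half domain; the leaves
    (hbox : ∀ p ∈ plaqsOf (half D), D.boxOf p ∈ D.halfcubes ∧ p ∈ D.plaqT (D.boxOf p))
    (L91h : ∀ U, new189 D U → ∀ p ∈ plaqsOf (half D),
      Ineq191 (dist1 (plaqHol (D.Upp U) p)) (D.devV'' U p) D.α ((D.L ^ D.h)⁻¹) (D.ε D.h) (E124 D.ε D.L D.η D.k D.h))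
    (L95 : ∀ U, new189 D U → ∀ p ∈ plaqsOf (half D),
      Ineq195 (D.devV'' U p) (dist1 (plaqHol (D.Uhalf U (D.boxOf p)) p)) D.α ((D.L ^ D.h)⁻¹) (D.ε D.h)
        (E124 D.ε D.L D.η D.k D.h))
    (L91 : ∀ U, new189 D U → ∀ j, D.h ≤ j → j ≤ D.k → ∀ p ∈ plaqsOf (dom D j),
      Ineq191 (dist1 (plaqHol (D.Upp U) p)) (D.dev97 U p) D.α ((D.L ^ j)⁻¹) (D.ε j) (E124 D.ε D.L D.η D.k j))
    (L97 : ∀ U, new189 D U → ∀ j, D.h ≤ j → j ≤ D.k → ∀ p ∈ plaqsOf (dom D j),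
      Ineq191 (D.dev97 U p) (D.dev0 U p) D.α ((D.L ^ j)⁻¹) (D.ε j) (E124 D.ε D.L D.η D.k j))
    (L80 : ∀ U, new189 D U → ∀ j, D.h ≤ j → j ≤ D.k → ∀ p ∈ plaqsOf (dom D j),
      B15.Ineq180 (D.dev0 U p) (D.ε D.k) D.η D.B₃ D.B₅ D.M D.δ (D.dist p) D.O1) :
    Claim189 (new189 D) (chiPP D) := by
  have hL1 : 1 ≤ D.L := by nlinarith
  have hL2 : 2 ≤ D.L := by nlinarith
  have hhK : D.h ≤ D.k := by omega
  have hXb : ∀ j, D.h ≤ j → j ≤ D.k → X D j ≤ (121 / 120) ^ 2 * (D.O1 * D.B₃ * D.B₅ * D.M ^ 5) := fun j hj hjk =>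
    X_le_of_levels D hα hL1 hB (hε0 j hj hjk) (hε1 j hj hjk)
  have hX0k : 0 ≤ X D D.k := by
    have : X D D.k = D.O1 * D.B₃ * D.B₅ * D.M ^ 5 * (1 + (D.L ^ D.k)⁻¹ * D.α * D.ε D.k) ^ 2 := by unfold X; ring
    rw [this]; exact mul_nonneg hB (sq_nonneg _)
  have hlarge : X D D.k * Real.exp (-(4 * D.δ * D.M)) ≤ D.α :=
    (mul_le_mul_of_nonneg_right (hXb D.k hhK le_rfl) (Real.exp_nonneg _)).trans hMlarge
  refine claim189_assembly_trunc D hhk hk hΩ hΩtop hα hβ0 hβ hL₀ hL₀L hε0 hε1 hB hδ hdist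
    (X' := 2 + (121 / 120) ^ 2 * (D.O1 * D.B₃ * D.B₅ * D.M ^ 5)) (fun j hj hjk => by linarith [hXb j hj hjk]) hN₀ hjEqK ?_
    (hscale_of_flow_bdd D hL2 hβ₀0 hβ₀ hε0 hflow) hbox L91h L95 L91 L97 L80
  intro m hm hmk p hp
  exact (lastTerm_le hX0k hδ hM (hcollar m hm hmk p hp) (by linarith : 4 * (1 : ℝ) * D.M ≤ 4 * D.M) le_rfl).trans hlarge

omit [GaugeGroup G] in
/-- `hgeom ⇒ hcollar`: the printed shell form implies the form used (`M ≥ 0`, `m − k₀ ≥ 1`). [cite: Balaban1989LargeFieldI, p.200 (bookkeeping)] -/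
theorem hcollar_of_hgeom (D : Setting189 P G C ι) (hM : 0 ≤ D.M)
    (hgeom : ∀ m, D.k₀ < m → m < D.k → ∀ p ∈ plaqsOf (D.Ω m \ D.Ω (m + 1)), 4 * ((m : ℝ) - D.k₀) * D.M ≤ D.dist p) :
    ∀ m, D.k₀ < m → m < D.k → ∀ p ∈ plaqsOf (D.Ω m \ D.Ω (m + 1)), 4 * D.M ≤ D.dist p := by
  intro m hm hmk p hp
  have hg : (1 : ℝ) ≤ (m : ℝ) - D.k₀ := by
    have : (D.k₀ : ℝ) + 1 ≤ m := by exact_mod_cast hm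
    linarith
  have := hgeom m hm hmk p hp
  nlinarith

end Generic

section Display

open B15 (Ineq180)
open B15.BasicStep (Claim189)
open B15.PrelimIntegrations (Ineq191 Ineq195)
open B15Chi124DetSets (E124)
open B15DeterminingSets (MSField)
open B15Claim189Assembly (Setting189 new189 chiPP dom half)
open B15Claim189PinsOfHistory (D189OfHist sitOfHist pinLevels_h_le_k₀ pinLevels_k₀_add_two_le_k pinLevels_M_B_nonneg two_le_N0OfSeq_of_hist)
open B15Claim189PrintedConditions (omegaOfChain omegaOfChain_succ_subset omegaOfChain_top_subset hjEqK_of_nested)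
open B15Claim189N0OfRecord (N0OfSeq)
open B15Claim189ZppPin (zppOfChain_hZk)
open B15Claim189CubePin (hbox_sitOfHist_pinCubes hdist_pinDistAt)
open B15Claim189FlowAtRecord (epsOfRecord_nonneg_of_inInterval epsOfRecord_le_of_inInterval epsOfRecord_flow28a_of_inInterval)
open B15Claim189N0OfRecord (genSeq_le_succ_of_beta_nonneg)
open GaugeGroup (dist1)
open GaugeField (plaqHol)
open FlowStep (HBeta prefixOf)
open FlowStepRuns (genSeq)
open B14FlowStep (SmallnessFor)

variable {F : T4Family} {N : ℕ} [NeZero N] {ν : Stage7Numerics} {A₁ : ℝ} {M : ℕ} (Nm : ℕ) (P : B12.RunParams) (σ : Sit189 F N P.K) {g : ℕ → ℝ} {k' : ℕ}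
  (s : SeqOfRecord F ν M g P.K k') (p₁ : ℕ)

/-- **(1.89) AT THE TERM'S FULLY PINNED LETTERS ALONG ANY HISTORY, THE SHELL GEOMETRY READ AS USED** — module 14's `claim189_sitOfHist_of_flow` VERBATIM with the located input
`hgeom : 4(m−k₀)M ≤ dist(p,Λ)` weakened to `hcollar : 4M ≤ dist(p,Λ)` on the shells (window-free form; memory `N`, `N₀` parameters; situation `σ` generic).  For `D = D189OfHist ν P (sitOfHist ν A₁ M N P σ g s N₀ p₁) g`
(`hD`; instantiate `rfl`). [cite: Balaban1989LargeFieldI, (1.89) p.198, pp.199–200, (1.80) p.195; Balaban1988Convergent, (2.1) p.254, (2.8) p.256] -/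
theorem claim189_sitOfHist_of_collar (N₀ : ℕ)
    {D : Setting189 (F.P P.K) (SU N) (MSField (F.P P.K) (SU N) × ((j : ℕ) → VecField (F.P P.K) j (EuclideanSpace ℝ (Fin (N ^ 2 - 1))))) (Pt (F.P P.K).d)}
    (hD : D = D189OfHist ν P (sitOfHist ν A₁ M Nm P σ g s N₀ p₁) g)
    (hN2 : 2 ≤ N₀) (hNN : N₀ ≤ Nm) (hNk : N₀ ≤ k')
    (hβ0 : 0 ≤ σ.β) (hβ : σ.β ≤ 1 / 4) (hL₀ : 2 ≤ σ.L₀) (hL₀L : σ.L₀ ^ 2 ≤ ((F.P P.K).L : ℝ))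
    (hB : 0 ≤ σ.O1 * σ.B₃ * σ.B₅) (hδ : 0 ≤ σ.δ) (hdist : ∀ p, 0 ≤ σ.dist p)
    (hN₀ : (2 + (121 / 120) ^ 2 * (σ.O1 * σ.B₃ * σ.B₅ * (M : ℝ) ^ 5)) * ((σ.L₀ ^ 2) ^ (N₀ - 1))⁻¹ ≤ 1 / 4)
    (hMl : (121 / 120) ^ 2 * (σ.O1 * σ.B₃ * σ.B₅ * (M : ℝ) ^ 5) * Real.exp (-(4 * σ.δ * (M : ℝ))) ≤ 1 / 12)
    (hε0 : ∀ i, k' - Nm ≤ i → i ≤ k' → 0 ≤ epsOfRecord ν g i) (hε1 : ∀ i, k' - Nm ≤ i → i ≤ k' → epsOfRecord ν g i ≤ 1 / 10)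
    {β₀ : ℝ} (hβ₀0 : 0 ≤ β₀) (hβ₀ : β₀ ≤ 1 / 2)
    (hflow : ∀ j, k' - Nm ≤ j → j < k' → epsOfRecord ν g k' ≤ (1 + β₀) * Real.sqrt ((k' - j : ℕ) : ℝ) * epsOfRecord ν g j)
    (hZk : ∀ m, k' - N₀ < m → m < k' → σ.Zpp k' ∩ omegaOfChain s m ⊆ omegaOfChain s (m + 1))
    (hcollar : ∀ m, D.k₀ < m → m < D.k → ∀ p ∈ plaqsOf (D.Ω m \ D.Ω (m + 1)), 4 * D.M ≤ D.dist p)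
    (hbox : ∀ p ∈ plaqsOf (half D), D.boxOf p ∈ D.halfcubes ∧ p ∈ D.plaqT (D.boxOf p))
    (L91h : ∀ U, new189 D U → ∀ p ∈ plaqsOf (half D),
      Ineq191 (dist1 (plaqHol (D.Upp U) p)) (D.devV'' U p) D.α ((D.L ^ D.h)⁻¹) (D.ε D.h) (E124 D.ε D.L D.η D.k D.h))
    (L95 : ∀ U, new189 D U → ∀ p ∈ plaqsOf (half D),
      Ineq195 (D.devV'' U p) (dist1 (plaqHol (D.Uhalf U (D.boxOf p)) p)) D.α ((D.L ^ D.h)⁻¹) (D.ε D.h) (E124 D.ε D.L D.η D.k D.h))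
    (L91 : ∀ U, new189 D U → ∀ j, D.h ≤ j → j ≤ D.k → ∀ p ∈ plaqsOf (dom D j),
      Ineq191 (dist1 (plaqHol (D.Upp U) p)) (D.dev97 U p) D.α ((D.L ^ j)⁻¹) (D.ε j) (E124 D.ε D.L D.η D.k j))
    (L97 : ∀ U, new189 D U → ∀ j, D.h ≤ j → j ≤ D.k → ∀ p ∈ plaqsOf (dom D j),
      Ineq191 (D.dev97 U p) (D.dev0 U p) D.α ((D.L ^ j)⁻¹) (D.ε j) (E124 D.ε D.L D.η D.k j))
    (L80 : ∀ U, new189 D U → ∀ j, D.h ≤ j → j ≤ D.k → ∀ p ∈ plaqsOf (dom D j),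
      Ineq180 (D.dev0 U p) (D.ε D.k) D.η D.B₃ D.B₅ D.M D.δ (D.dist p) D.O1) :
    Claim189 (new189 D) (chiPP D) := by
  subst hD
  have hN₀' : (2 + (121 / 120) ^ 2 * (σ.O1 * σ.B₃ * σ.B₅ * (M : ℝ) ^ 5)) * ((σ.L₀ ^ 2) ^ (k' - (k' - N₀) - 1))⁻¹ ≤ 1 / 4 := by
    rw [show k' - (k' - N₀) - 1 = N₀ - 1 from by omega]; exact hN₀
  exact claim189_assembly_printed_of_collar (D189OfHist ν P (sitOfHist ν A₁ M Nm P σ g s N₀ p₁) g)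
    (pinLevels_h_le_k₀ (σ.pinTerm s) M Nm N₀ hNN) (pinLevels_k₀_add_two_le_k (σ.pinTerm s) M Nm N₀ hN2 hNk)
    (omegaOfChain_succ_subset s) (omegaOfChain_top_subset s le_rfl) rfl hβ0 hβ hL₀ hL₀L hε0 hε1
    (pinLevels_M_B_nonneg (σ.pinTerm s) M Nm N₀ hB).2 hδ (Nat.cast_nonneg _) hdist hN₀' hMl
    (hjEqK_of_nested _ (omegaOfChain_succ_subset s) hZk) hcollar hβ₀0 hβ₀ hflow hbox L91h L95 L91 L97 L80

/-- ★★★ **(1.89) AT THE TERM'S FULLY PINNED SITUATION WITH `Λ` OF (1.73), THE CUBE DATA, THE DISTANCE LETTER, `N₀` AND `Z″` OF THE HISTORY — EVERY LOCATED-GEOMETRY INPUT DISCHARGED**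
(window-free form).  At `σ′ = σ₂.pinCubes ((Ω″^∼_{h+1})ᶜ ∩ Ω_h)`, `σ₂ = ((σ.pinLambda s N₀ enlD).pinDistAt k′).pinZpp s N₀ N enlD`, `N₀ := N0OfSeq L r g k′`, for
`D = D189OfHist ν P (sitOfHist ν A₁ M N P σ′ g s N₀ p₁) g` (`hD`, instantiate `rfl`): `Claim189 (new189 D) (chiPP D)` — with «We have j = k» (`hZk`, module 13), the (1.88) cover (`hbox`,
module 15), `dist ≥ 0` (`hdist`, module 15) AND the shell bound (`hgeom`, HERE, through `hcollar_sitOfHist_pinLambda`) all THEOREMS, and the enlargement's inflationarity (`henl`) too.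
DISPLAYED remain: `1 < (log g_{k′}⁻²)^r` (⇒ `2 ≤ N₀`), `N₀ ≤ N`, `N₀ ≤ k′`; residual numerics `0 ≤ β ≤ 1/4`, `2 ≤ L₀`, `L₀² ≤ L`, signs, `0 < σ.sh`, **`0 < M`**; print's two p. 200 conditions;
the flow inputs; ONE STEP of monotone couplings `0 < g_{k′+1−N₀} ≤ g_{k′+2−N₀} ≤ 1` (the `N₀`-equation, §3); **`Λ ≠ ∅`** (`(Ω^{∼4}_{k₀+1})ᶜ ∩ Z` nonempty — a non-trivial 𝐑-step);
the four ℍ-leaves and (1.80). [cite: Balaban1989LargeFieldI, (1.89) p.198, (1.73) p.192, (1.10)–(1.11) p.179, (1.80) p.195, (1.88) p.198, pp.199–200; Balaban1988Convergent, (2.1) p.254, (2.5)–(2.8) pp.255–256, (2.17) p.257] -/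
theorem claim189_sitOfHist_Λ_of_flow (hsh : 0 < σ.sh) (hM : 0 < M)
    {D : Setting189 (F.P P.K) (SU N) (MSField (F.P P.K) (SU N) × ((j : ℕ) → VecField (F.P P.K) j (EuclideanSpace ℝ (Fin (N ^ 2 - 1))))) (Pt (F.P P.K).d)}
    (hD : D = D189OfHist ν P (sitOfHist ν A₁ M Nm P
      ((((σ.pinLambda s (N0OfSeq (F.P P.K).L ν.r g k') (enlD F ν M P g)).pinDistAt k').pinZpp s (N0OfSeq (F.P P.K).L ν.r g k') Nm (enlD F ν M P g)).pinCubes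
        ((((σ.pinLambda s (N0OfSeq (F.P P.K).L ν.r g k') (enlD F ν M P g)).pinDistAt k').pinZpp s (N0OfSeq (F.P P.K).L ν.r g k') Nm (enlD F ν M P g)).OmTᶜ ∩
          omegaOfChain s (k' - Nm))) g s (N0OfSeq (F.P P.K).L ν.r g k') p₁) g)
    (hlog : 1 < (Real.log (g k' ^ 2)⁻¹) ^ ν.r) (hNN : N0OfSeq (F.P P.K).L ν.r g k' ≤ Nm) (hNk : N0OfSeq (F.P P.K).L ν.r g k' ≤ k')
    (hβ0 : 0 ≤ σ.β) (hβ : σ.β ≤ 1 / 4) (hL₀ : 2 ≤ σ.L₀) (hL₀L : σ.L₀ ^ 2 ≤ ((F.P P.K).L : ℝ))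
    (hB : 0 ≤ σ.O1 * σ.B₃ * σ.B₅) (hδ : 0 ≤ σ.δ)
    (hN₀ : (2 + (121 / 120) ^ 2 * (σ.O1 * σ.B₃ * σ.B₅ * (M : ℝ) ^ 5)) * ((σ.L₀ ^ 2) ^ (N0OfSeq (F.P P.K).L ν.r g k' - 1))⁻¹ ≤ 1 / 4)
    (hMl : (121 / 120) ^ 2 * (σ.O1 * σ.B₃ * σ.B₅ * (M : ℝ) ^ 5) * Real.exp (-(4 * σ.δ * (M : ℝ))) ≤ 1 / 12)
    (hε0 : ∀ i, k' - Nm ≤ i → i ≤ k' → 0 ≤ epsOfRecord ν g i) (hε1 : ∀ i, k' - Nm ≤ i → i ≤ k' → epsOfRecord ν g i ≤ 1 / 10)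
    {β₀ : ℝ} (hβ₀0 : 0 ≤ β₀) (hβ₀ : β₀ ≤ 1 / 2)
    (hflow : ∀ j, k' - Nm ≤ j → j < k' → epsOfRecord ν g k' ≤ (1 + β₀) * Real.sqrt ((k' - j : ℕ) : ℝ) * epsOfRecord ν g j)
    (hgpos : 0 < g (k' + 1 - N0OfSeq (F.P P.K).L ν.r g k')) (hgstep : g (k' + 1 - N0OfSeq (F.P P.K).L ν.r g k') ≤ g (k' + 2 - N0OfSeq (F.P P.K).L ν.r g k'))
    (hgle : g (k' + 2 - N0OfSeq (F.P P.K).L ν.r g k') ≤ 1)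
    (hΛ : ((enlD F ν M P g 4 (k' + 1 - N0OfSeq (F.P P.K).L ν.r g k') (omegaOfChain s (k' + 1 - N0OfSeq (F.P P.K).L ν.r g k')))ᶜ ∩ σ.Z).Nonempty)
    (L91h : ∀ U, new189 D U → ∀ p ∈ plaqsOf (half D),
      Ineq191 (dist1 (plaqHol (D.Upp U) p)) (D.devV'' U p) D.α ((D.L ^ D.h)⁻¹) (D.ε D.h) (E124 D.ε D.L D.η D.k D.h))
    (L95 : ∀ U, new189 D U → ∀ p ∈ plaqsOf (half D),
      Ineq195 (D.devV'' U p) (dist1 (plaqHol (D.Uhalf U (D.boxOf p)) p)) D.α ((D.L ^ D.h)⁻¹) (D.ε D.h) (E124 D.ε D.L D.η D.k D.h))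
    (L91 : ∀ U, new189 D U → ∀ j, D.h ≤ j → j ≤ D.k → ∀ p ∈ plaqsOf (dom D j),
      Ineq191 (dist1 (plaqHol (D.Upp U) p)) (D.dev97 U p) D.α ((D.L ^ j)⁻¹) (D.ε j) (E124 D.ε D.L D.η D.k j))
    (L97 : ∀ U, new189 D U → ∀ j, D.h ≤ j → j ≤ D.k → ∀ p ∈ plaqsOf (dom D j),
      Ineq191 (D.dev97 U p) (D.dev0 U p) D.α ((D.L ^ j)⁻¹) (D.ε j) (E124 D.ε D.L D.η D.k j))
    (L80 : ∀ U, new189 D U → ∀ j, D.h ≤ j → j ≤ D.k → ∀ p ∈ plaqsOf (dom D j),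
      Ineq180 (D.dev0 U p) (D.ε D.k) D.η D.B₃ D.B₅ D.M D.δ (D.dist p) D.O1) :
    Claim189 (new189 D) (chiPP D) := by
  have hN2 : 2 ≤ N0OfSeq (F.P P.K).L ν.r g k' := two_le_N0OfSeq_of_hist ν P g hlog
  exact claim189_sitOfHist_of_collar Nm P ((((σ.pinLambda s (N0OfSeq (F.P P.K).L ν.r g k') (enlD F ν M P g)).pinDistAt k').pinZpp s (N0OfSeq (F.P P.K).L ν.r g k') Nm (enlD F ν M P g)).pinCubes ((((σ.pinLambda s (N0OfSeq (F.P P.K).L ν.r g k') (enlD F ν M P g)).pinDistAt k').pinZpp s (N0OfSeq (F.P P.K).L ν.r g k') Nm (enlD F ν M P g)).OmTᶜ ∩ omegaOfChain s (k' - Nm))) s p₁ (N0OfSeq (F.P P.K).L ν.r g k') hD hN2 hNN hNk hβ0 hβ hL₀ hL₀L hB hδ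
    (hdist_pinDistAt (σ.pinLambda s (N0OfSeq (F.P P.K).L ν.r g k') (enlD F ν M P g)) k') hN₀ hMl hε0 hε1 hβ₀0 hβ₀ hflow
    (zppOfChain_hZk s (N0OfSeq (F.P P.K).L ν.r g k') Nm _ (enlD F ν M P g) _ (subset_enlD hM) hN2 hNN)
    (hcollar_sitOfHist_pinLambda Nm P σ s (N0OfSeq (F.P P.K).L ν.r g k') p₁ _ hD hΛ (by omega) hNk (hR_of_monotone_step P hgpos hgstep hgle))
    (hbox_sitOfHist_pinCubes P (((σ.pinLambda s (N0OfSeq (F.P P.K).L ν.r g k') (enlD F ν M P g)).pinDistAt k').pinZpp s (N0OfSeq (F.P P.K).L ν.r g k') Nm (enlD F ν M P g)) g Nm s (N0OfSeq (F.P P.K).L ν.r g k') p₁ hsh hD) L91h L95 L91 L97 L80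

/-- **ONE STEP OF MONOTONE COUPLINGS IN THE WINDOW** — the `N₀`-equation's inputs along a generated history `g = genSeq β g₀` in `]0, γ]` up to `k′` with `β ≥ 0` along it ([I] Thm 2's input)
and `γ ≤ 1`: `0 < g_{k′+1−N₀} ≤ g_{k′+2−N₀} ≤ 1` for `2 ≤ N₀ ≤ k′`. [cite: Balaban1987RG1, (0.20) p.256, §1 p.264; Balaban1988Convergent, (2.6) p.255] -/
theorem coupling_step_of_inInterval (β : HBeta) (g0 : ℝ) {γ : ℝ} (hγ1 : γ ≤ 1) {n : ℕ} (hI : Step.InInterval γ n (genSeq β g0))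
    (hβhist : ∀ j, j < n → 0 ≤ β j (prefixOf (genSeq β g0) j)) {N₀ : ℕ} (hN2 : 2 ≤ N₀) (hNk : N₀ ≤ n) :
    0 < genSeq β g0 (n + 1 - N₀) ∧ genSeq β g0 (n + 1 - N₀) ≤ genSeq β g0 (n + 2 - N₀) ∧ genSeq β g0 (n + 2 - N₀) ≤ 1 := by
  have h1 := hI (n + 1 - N₀) (by omega)
  have h2 := hI (n + 2 - N₀) (by omega)
  refine ⟨h1.1, ?_, h2.2.trans hγ1⟩
  have e : n + 2 - N₀ = (n + 1 - N₀) + 1 := by omega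
  rw [e] at h2 ⊢
  exact genSeq_le_succ_of_beta_nonneg β g0 h1.1 h2.1 (hβhist _ (by omega))

/-- ★★★ **THE SAME ALONG A GENERATED HISTORY IN A (2.7)-SMALL WINDOW** — module 14's `claim189_sitOfHist_of_inInterval` with EVERY located-geometry input discharged: `g = genSeq β g₀` in `]0, γ]`
up to `k′`, `β ≤ β′` and **`β ≥ 0`** along it, `SmallnessFor γ β′ β₀ L p₀`, `β₀ ≤ ½`, `0 ≤ A₀`, `γA₀(log γ⁻²)^{p₀} ≤ 1/10` DISCHARGE the flow inputs (module 5) AND the `N₀`-equation's coupling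
step (`coupling_step_of_inInterval`).  DISPLAYED remain: `1 < (log g_{k′}⁻²)^r`, `N₀ ≤ N`, `N₀ ≤ k′`; residual numerics and signs, `0 < σ.sh`, `0 < M`; print's two p. 200 conditions (the
first a theorem in the window by module 12's threshold — kept closed-form here); `Λ ≠ ∅`; the four ℍ-leaves and (1.80).
[cite: Balaban1989LargeFieldI, (1.89) p.198, (1.73) p.192, pp.199–200; Balaban1988Convergent, (2.1) p.254, (2.4)–(2.8) pp.255–256; Balaban1987RG1, (0.20) p.256] -/
theorem claim189_sitOfHist_Λ_of_inInterval (β : HBeta) {s : SeqOfRecord F ν M (genSeq β P.g0) P.K k'} (hsh : 0 < σ.sh) (hM : 0 < M)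
    {D : Setting189 (F.P P.K) (SU N) (MSField (F.P P.K) (SU N) × ((j : ℕ) → VecField (F.P P.K) j (EuclideanSpace ℝ (Fin (N ^ 2 - 1))))) (Pt (F.P P.K).d)}
    (hD : D = D189OfHist ν P (sitOfHist ν A₁ M Nm P ((((σ.pinLambda s (N0OfSeq (F.P P.K).L ν.r (genSeq β P.g0) k') (enlD F ν M P (genSeq β P.g0))).pinDistAt k').pinZpp s (N0OfSeq (F.P P.K).L ν.r (genSeq β P.g0) k') Nm (enlD F ν M P (genSeq β P.g0))).pinCubes ((((σ.pinLambda s (N0OfSeq (F.P P.K).L ν.r (genSeq β P.g0) k') (enlD F ν M P (genSeq β P.g0))).pinDistAt k').pinZpp s (N0OfSeq (F.P P.K).L ν.r (genSeq β P.g0) k') Nm (enlD F ν M P (genSeq β P.g0))).OmTᶜ ∩ omegaOfChain s (k' - Nm))) (genSeq β P.g0) s (N0OfSeq (F.P P.K).L ν.r (genSeq β P.g0) k') p₁) (genSeq β P.g0))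
    (hlog : 1 < (Real.log (genSeq β P.g0 k' ^ 2)⁻¹) ^ ν.r) (hNN : (N0OfSeq (F.P P.K).L ν.r (genSeq β P.g0) k') ≤ Nm) (hNk : (N0OfSeq (F.P P.K).L ν.r (genSeq β P.g0) k') ≤ k')
    (hβ0 : 0 ≤ σ.β) (hβ : σ.β ≤ 1 / 4) (hL₀ : 2 ≤ σ.L₀) (hL₀L : σ.L₀ ^ 2 ≤ ((F.P P.K).L : ℝ))
    (hB : 0 ≤ σ.O1 * σ.B₃ * σ.B₅) (hδ : 0 ≤ σ.δ)
    (hN₀ : (2 + (121 / 120) ^ 2 * (σ.O1 * σ.B₃ * σ.B₅ * (M : ℝ) ^ 5)) * ((σ.L₀ ^ 2) ^ ((N0OfSeq (F.P P.K).L ν.r (genSeq β P.g0) k') - 1))⁻¹ ≤ 1 / 4)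
    (hMl : (121 / 120) ^ 2 * (σ.O1 * σ.B₃ * σ.B₅ * (M : ℝ) ^ 5) * Real.exp (-(4 * σ.δ * (M : ℝ))) ≤ 1 / 12)
    (hA₀ : 0 ≤ ν.A₀) {γ β' β₀ : ℝ} {L : ℕ} (S : SmallnessFor γ β' β₀ L ν.p₀) (hβ₀ : β₀ ≤ 1 / 2) (hε10 : γ * p0Profile ν.A₀ ν.p₀ γ ≤ 1 / 10)
    (hI : Step.InInterval γ k' (genSeq β P.g0)) (hub : ∀ j, j < k' → β j (prefixOf (genSeq β P.g0) j) ≤ β')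
    (hβhist : ∀ j, j < k' → 0 ≤ β j (prefixOf (genSeq β P.g0) j))
    (hΛ : (((enlD F ν M P (genSeq β P.g0)) 4 (k' + 1 - (N0OfSeq (F.P P.K).L ν.r (genSeq β P.g0) k')) (omegaOfChain s (k' + 1 - (N0OfSeq (F.P P.K).L ν.r (genSeq β P.g0) k'))))ᶜ ∩ σ.Z).Nonempty)
    (L91h : ∀ U, new189 D U → ∀ p ∈ plaqsOf (half D),
      Ineq191 (dist1 (plaqHol (D.Upp U) p)) (D.devV'' U p) D.α ((D.L ^ D.h)⁻¹) (D.ε D.h) (E124 D.ε D.L D.η D.k D.h))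
    (L95 : ∀ U, new189 D U → ∀ p ∈ plaqsOf (half D),
      Ineq195 (D.devV'' U p) (dist1 (plaqHol (D.Uhalf U (D.boxOf p)) p)) D.α ((D.L ^ D.h)⁻¹) (D.ε D.h) (E124 D.ε D.L D.η D.k D.h))
    (L91 : ∀ U, new189 D U → ∀ j, D.h ≤ j → j ≤ D.k → ∀ p ∈ plaqsOf (dom D j),
      Ineq191 (dist1 (plaqHol (D.Upp U) p)) (D.dev97 U p) D.α ((D.L ^ j)⁻¹) (D.ε j) (E124 D.ε D.L D.η D.k j))
    (L97 : ∀ U, new189 D U → ∀ j, D.h ≤ j → j ≤ D.k → ∀ p ∈ plaqsOf (dom D j),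
      Ineq191 (D.dev97 U p) (D.dev0 U p) D.α ((D.L ^ j)⁻¹) (D.ε j) (E124 D.ε D.L D.η D.k j))
    (L80 : ∀ U, new189 D U → ∀ j, D.h ≤ j → j ≤ D.k → ∀ p ∈ plaqsOf (dom D j),
      Ineq180 (D.dev0 U p) (D.ε D.k) D.η D.B₃ D.B₅ D.M D.δ (D.dist p) D.O1) :
    Claim189 (new189 D) (chiPP D) := by
  have hN2 : 2 ≤ (N0OfSeq (F.P P.K).L ν.r (genSeq β P.g0) k') := two_le_N0OfSeq_of_hist ν P (genSeq β P.g0) hlog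
  obtain ⟨hgpos, hgstep, hgle⟩ := coupling_step_of_inInterval β P.g0 S.γ_lt_one.le hI hβhist hN2 hNk
  refine claim189_sitOfHist_Λ_of_flow Nm P σ s p₁ hsh hM hD hlog hNN hNk hβ0 hβ hL₀ hL₀L hB hδ hN₀ hMl
    (fun i _ hik => epsOfRecord_nonneg_of_inInterval ν hA₀ S.γ_lt_one.le hI hik) (fun i _ hik => epsOfRecord_le_of_inInterval ν hA₀ S hε10 hI hik)
    S.β₀_pos.le hβ₀ (fun j _ hjk => ?_) hgpos hgstep hgle hΛ L91h L95 L91 L97 L80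
  rw [Nat.cast_sub hjk.le]
  exact epsOfRecord_flow28a_of_inInterval ν hA₀ S β P.g0 hI hub hjk le_rfl

end Display

/-! ## §7. AT RECORD 13: the window form along `gOfRecord₁₃ θ P = genSeq (betaOfRecord₁₃ θ) g₀` with `N₀ := N0OfRecord₁₃ θ P k′` -/

section Record13

open B15 (Ineq180)
open B15.BasicStep (Claim189)
open B15.PrelimIntegrations (Ineq191 Ineq195)
open B15Chi124DetSets (E124)
open B15DeterminingSets (MSField)
open B15Claim189Assembly (Setting189 new189 chiPP dom half)
open B15Claim189PinsOfHistory (D189OfHist sitOfHist N0OfRecord₁₃ two_le_N0OfSeq_of_hist one_lt_log_pow_of_inInterval_hist printCond1_N0OfSeq_of_threshold)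
open B15Claim189PrintedConditions (omegaOfChain)
open B15Claim189FlowAtRecord (betaAlongHistory_le_of_betaUpperH)
open GaugeGroup (dist1)
open GaugeField (plaqHol)
open FlowStep (HBeta prefixOf BetaUpperH)
open FlowStepRuns (genSeq)
open B14FlowStep (SmallnessFor)

variable {F : T4Family} {N : ℕ} [NeZero N] {θ : Stage13Params F N} (Nm : ℕ) (P : B12.RunParams) (σ : Sit189 F N P.K) {k' : ℕ}
  (s : SeqOfRecord F θ.ν θ.τ9.M (gOfRecord₁₃ F N θ P) P.K k') (p₁ : ℕ)

/-- ★★★ **(1.89) AT THE TERM'S FULLY PINNED LETTERS OF RECORD 13 WITH `Λ` OF (1.73) — EVERY LOCATED-GEOMETRY INPUT DISCHARGED, IN THE RUN'S (2.7)-SMALL WINDOW** (module 14's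
`claim189_sitOfHist₁₃_N0_of_inInterval` at the `Λ`-, distance-, `Z″`- and cube-pinned situation over the enlargement of record): the level input `2 ≤ N₀` from `r ≥ 1`, print's first p. 200
condition from ONE threshold on `g_{k′}` (`hwin`) and `β₁₃ ≥ 0` along the history, the flow inputs AND the `N₀`-equation's coupling step from the window `]0, θ.γ]` up to `k′` with the BOX
bound `BetaUpperH β′ θ.γ (betaOfRecord₁₃ θ)`.  DISPLAYED: memory `N ≥ N₀(P)`, `N₀(P) ≤ k′`, residual numerics ∕ signs, `0 < σ.sh`, `0 < M`, print's second condition, `Λ ≠ ∅`, the four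
ℍ-leaves and (1.80) — and NO located geometry.  HONEST REACH (ref-I NIT-H1 on module 4's sequel, restated): at the witness numerics of record `θ₁₃.τ9.Nmem = 0`, so `N ≥ N₀(P) ≥ 2` binds only
at a numerics edition with `Nmem ≥ 2` (print: `N > N₀`, p. 179); `M` of record is `1` there (`0 < M` holds; print's «M large» is the residual `hMl`).
[cite: Balaban1989LargeFieldI, (1.89) p.198, (1.73) p.192, p.179, pp.199–200; Balaban1988Convergent, (2.1) p.254, (2.4)–(2.8) pp.255–256; Balaban1987RG1, (0.20) p.256, §1 p.264] -/
theorem claim189_sitOfHist₁₃_Λ_of_inInterval (hsh : 0 < σ.sh) (hM : 0 < θ.τ9.M)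
    {D : Setting189 (F.P P.K) (SU N) (MSField (F.P P.K) (SU N) × ((j : ℕ) → VecField (F.P P.K) j (EuclideanSpace ℝ (Fin (N ^ 2 - 1))))) (Pt (F.P P.K).d)}
    (hD : D = D189OfHist θ.ν P (sitOfHist θ.ν θ.A₁ θ.τ9.M Nm P ((((σ.pinLambda s (N0OfRecord₁₃ θ P k') (enlD F θ.ν θ.τ9.M P (gOfRecord₁₃ F N θ P))).pinDistAt k').pinZpp s (N0OfRecord₁₃ θ P k') Nm (enlD F θ.ν θ.τ9.M P (gOfRecord₁₃ F N θ P))).pinCubes ((((σ.pinLambda s (N0OfRecord₁₃ θ P k') (enlD F θ.ν θ.τ9.M P (gOfRecord₁₃ F N θ P))).pinDistAt k').pinZpp s (N0OfRecord₁₃ θ P k') Nm (enlD F θ.ν θ.τ9.M P (gOfRecord₁₃ F N θ P))).OmTᶜ ∩ omegaOfChain s (k' - Nm))) (gOfRecord₁₃ F N θ P) s (N0OfRecord₁₃ θ P k') p₁) (gOfRecord₁₃ F N θ P))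
    (hr : 1 ≤ θ.ν.r) (hNN : (N0OfRecord₁₃ θ P k') ≤ Nm) (hNk : (N0OfRecord₁₃ θ P k') ≤ k')
    (hβ0 : 0 ≤ σ.β) (hβ : σ.β ≤ 1 / 4) (hL₀ : 2 ≤ σ.L₀) (hL₀L : σ.L₀ ^ 2 ≤ ((F.P P.K).L : ℝ))
    (hB : 0 ≤ σ.O1 * σ.B₃ * σ.B₅) (hδ : 0 ≤ σ.δ)
    (hwin : 4 * (2 + (121 / 120) ^ 2 * (σ.O1 * σ.B₃ * σ.B₅ * (θ.τ9.M : ℝ) ^ 5))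
      ≤ ((Real.log ((gOfRecord₁₃ F N θ P) k' ^ 2)⁻¹) ^ θ.ν.r) ^ (Real.log (σ.L₀ ^ 2) / Real.log ((F.P P.K).L : ℝ)))
    (hβhist : ∀ j, j < k' → 0 ≤ betaOfRecord₁₃ F N θ j (prefixOf (gOfRecord₁₃ F N θ P) j))
    (hMl : (121 / 120) ^ 2 * (σ.O1 * σ.B₃ * σ.B₅ * (θ.τ9.M : ℝ) ^ 5) * Real.exp (-(4 * σ.δ * (θ.τ9.M : ℝ))) ≤ 1 / 12)
    (hA₀ : 0 ≤ θ.ν.A₀) {β' β₀ : ℝ} {L : ℕ} (S : SmallnessFor θ.γ β' β₀ L θ.ν.p₀) (hβ₀ : β₀ ≤ 1 / 2) (hε10 : θ.γ * p0Profile θ.ν.A₀ θ.ν.p₀ θ.γ ≤ 1 / 10)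
    (hI : Step.InInterval θ.γ k' (gOfRecord₁₃ F N θ P)) (hup : BetaUpperH β' θ.γ (betaOfRecord₁₃ F N θ))
    (hΛ : (((enlD F θ.ν θ.τ9.M P (gOfRecord₁₃ F N θ P)) 4 (k' + 1 - (N0OfRecord₁₃ θ P k')) (omegaOfChain s (k' + 1 - (N0OfRecord₁₃ θ P k'))))ᶜ ∩ σ.Z).Nonempty)
    (L91h : ∀ U, new189 D U → ∀ p ∈ plaqsOf (half D),
      Ineq191 (dist1 (plaqHol (D.Upp U) p)) (D.devV'' U p) D.α ((D.L ^ D.h)⁻¹) (D.ε D.h) (E124 D.ε D.L D.η D.k D.h))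
    (L95 : ∀ U, new189 D U → ∀ p ∈ plaqsOf (half D),
      Ineq195 (D.devV'' U p) (dist1 (plaqHol (D.Uhalf U (D.boxOf p)) p)) D.α ((D.L ^ D.h)⁻¹) (D.ε D.h) (E124 D.ε D.L D.η D.k D.h))
    (L91 : ∀ U, new189 D U → ∀ j, D.h ≤ j → j ≤ D.k → ∀ p ∈ plaqsOf (dom D j),
      Ineq191 (dist1 (plaqHol (D.Upp U) p)) (D.dev97 U p) D.α ((D.L ^ j)⁻¹) (D.ε j) (E124 D.ε D.L D.η D.k j))
    (L97 : ∀ U, new189 D U → ∀ j, D.h ≤ j → j ≤ D.k → ∀ p ∈ plaqsOf (dom D j),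
      Ineq191 (D.dev97 U p) (D.dev0 U p) D.α ((D.L ^ j)⁻¹) (D.ε j) (E124 D.ε D.L D.η D.k j))
    (L80 : ∀ U, new189 D U → ∀ j, D.h ≤ j → j ≤ D.k → ∀ p ∈ plaqsOf (dom D j),
      Ineq180 (D.dev0 U p) (D.ε D.k) D.η D.B₃ D.B₅ D.M D.δ (D.dist p) D.O1) :
    Claim189 (new189 D) (chiPP D) :=
  claim189_sitOfHist_Λ_of_inInterval Nm P σ p₁ (betaOfRecord₁₃ F N θ) hsh hM hD
    (one_lt_log_pow_of_inInterval_hist θ.ν S hI hr) hNN hNk hβ0 hβ hL₀ hL₀L hB hδ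
    (printCond1_N0OfSeq_of_threshold θ.ν P (betaOfRecord₁₃ F N θ) S.γ_lt_one.le hI hβhist (by linarith) hwin) hMl hA₀ S hβ₀ hε10 hI
    (betaAlongHistory_le_of_betaUpperH hup hI) hβhist hΛ L91h L95 L91 L97 L80

end Record13

/-! ## §8. CENSUS (A2): the side condition `Λ ≠ ∅` is load-bearing; the enlargement of record is void at `M = 0` -/

section Census

open B15Claim189PrintedConditions (omegaOfChain)

variable {F : T4Family} {N : ℕ} [NeZero N] {ν : Stage7Numerics} {M : ℕ} (P : B12.RunParams) (σ : Sit189 F N P.K) {g : ℕ → ℝ} {k' : ℕ}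
  (s : SeqOfRecord F ν M g P.K k') (N₀ : ℕ) (enl : ℕ → ℕ → Set (Site (F.P P.K) 0) → Set (Site (F.P P.K) 0))

/-- CENSUS (A2): if the situation's component union `Z` lies inside `Ω^{∼4}_{k₀+1}` (in particular if `Z = ∅`), the pinned `Λ` is EMPTY and the pinned distance is `0` everywhere — then
`4M ≤ dist(p, Λ)` fails on any shell plaquette once `M > 0`: the displayed side condition `Λ ≠ ∅` of §5–§7 is load-bearing, not decorative. [cite: Balaban1989LargeFieldI, (1.73) p.192, (1.80) p.195 (bookkeeping census)] -/
theorem pinLambda_dist_eq_zero_of_subset (hZ : σ.Z ⊆ enl 4 (k' + 1 - N₀) (omegaOfChain s (k' + 1 - N₀))) (k : ℕ) (p : Plaq (F.P P.K) 0) :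
    ((σ.pinLambda s N₀ enl).pinDistAt k).dist p = 0 := by
  have hΛ : (σ.pinLambda s N₀ enl).Λ = ∅ := by
    rw [pinLambda_Λ, Set.eq_empty_iff_forall_notMem]
    rintro x ⟨hx, hxZ⟩
    exact hx (hZ hxZ)
  show distOfRecord (σ.pinLambda s N₀ enl).Λ k p = 0
  rw [hΛ]
  exact B15Claim189CubePin.distOfRecord_empty k p

/-- CENSUS (A2): at `M = 0` the `𝐃`-cubes of record have side `0`, the index family is empty and the enlargement of record is the EMPTY set (NOT inflationary) — the displayed `0 < M` of
§6–§7 is load-bearing for module 13's `henl`. [cite: Balaban1988Convergent, (2.1) p.254 (bookkeeping census)] -/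
theorem enlD_of_M_eq_zero (ν : Stage7Numerics) (P : B12.RunParams) (g : ℕ → ℝ) (n j : ℕ) (S : Set (Site (F.P P.K) 0)) :
    enlD F ν 0 P g n j S = ∅ := by
  classical
  have hside : dCubeSide (F.P P.K).L 0 (RkOfRecord (F.P P.K).L ν.r (g j)) j = 0 := by unfold dCubeSide; simp
  rw [enlD_apply, hside, Set.eq_empty_iff_forall_notMem]
  intro x hx
  unfold hullD at hx
  obtain ⟨a, ha, -⟩ := Set.mem_iUnion₂.1 hx
  have ha' := (Finset.mem_filter.1 ha).1
  unfold cubeIndices at ha'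
  rw [Fintype.mem_piFinset] at ha'
  have h0 := ha' ⟨0, (F.P P.K).hd⟩
  simp at h0

end Census



/-! ## §9. (v1.1) The `Λ`-pinned RESIDUAL LAYER per run (module 14 §5's `pinD189TH` at the full pin stack) and dag-n12-d's `h189` slot supplied with NO located-geometry binder -/

section Layer

open B15 (Ineq180)
open B15.BasicStep (Claim189)
open B15.PrelimIntegrations (Ineq191 Ineq195)
open B15Chi124DetSets (E124)
open B15DeterminingSets (MSField)
open B15Claim189Assembly (Setting189 new189 chiPP dom half)
open B15Claim189PinsOfHistory (D189OfHist sitOfHist N0OfRecord₁₃)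
open B15Claim189PrintedConditions (omegaOfChain)
open B15Claim189N0OfRecord (N0OfSeq)
open GaugeGroup (dist1)
open GaugeField (plaqHol)
open FlowStep (prefixOf BetaUpperH)
open B14FlowStep (SmallnessFor)

variable {F : T4Family} {N : ℕ} [NeZero N]

/-- **THE `Λ`-PINNED RESIDUAL [IV] LAYER, BY THE TOKENS** — module 14 §5's `pinD189TH` read, per run `P`, at the FULL pin stack of this file: `Λ` of (1.73) over the enlargement of record
(`N₀ P := N0OfSeq L r (g P) (kSel P + 1)`, the `N₀` of the history), module 15's distance letter at `k = kSel P + 1`, module 13's `Z″` over the same enlargement, module 15's cube data over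
the half domain `(Ω″^∼_{h+1})ᶜ ∩ Ω_h` (`h = kSel P + 1 − N P`); then (inside `sitOfHist`) the term, levels, χ′ and `dev0` pins.  `kSel`, the Proposition-1 carrier and the (1.100) data
are untouched.  Data, no law. [cite: Balaban1989LargeFieldI, (1.89) p.198, (1.73) p.192, (1.10)–(1.11) p.179, (1.80) p.195, (1.88) p.198, p.200; Balaban1988Convergent, (2.1) p.254, (2.18) p.257] -/
def _root_.Literature.MathematicalPhysics.QuantumFieldTheory.Balaban1983to89.Node00.ResidW.pinD189ΛH (lam : ResidW F N) (ν : Stage7Numerics) (A₁ : ℝ) (M : ℕ)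
    (gT : B12.RunParams → ℕ → ℝ) (σT : ∀ P : B12.RunParams, Sit189 F N P.K) (sT : ∀ P : B12.RunParams, SeqOfRecord F ν M (gT P) P.K (lam.kSel P + 1))
    (NmT : B12.RunParams → ℕ) (p₁ : ℕ) : ResidW F N :=
  lam.pinD189TH ν A₁ M gT (fun P => (((((σT P).pinLambda (sT P) (N0OfSeq (F.P P.K).L ν.r (gT P) (lam.kSel P + 1)) (enlD F ν M P (gT P))).pinDistAt (lam.kSel P + 1)).pinZpp (sT P) (N0OfSeq (F.P P.K).L ν.r (gT P) (lam.kSel P + 1)) (NmT P) (enlD F ν M P (gT P))).pinCubes (((((σT P).pinLambda (sT P) (N0OfSeq (F.P P.K).L ν.r (gT P) (lam.kSel P + 1)) (enlD F ν M P (gT P))).pinDistAt (lam.kSel P + 1)).pinZpp (sT P) (N0OfSeq (F.P P.K).L ν.r (gT P) (lam.kSel P + 1)) (NmT P) (enlD F ν M P (gT P))).OmTᶜ ∩ omegaOfChain (sT P) (lam.kSel P + 1 - NmT P)))) sT NmT (fun P => (N0OfSeq (F.P P.K).L ν.r (gT P) (lam.kSel P + 1))) p₁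

variable (lam : ResidW F N) (ν : Stage7Numerics) (A₁ : ℝ) (M : ℕ) (gT : B12.RunParams → ℕ → ℝ) (σT : ∀ P : B12.RunParams, Sit189 F N P.K)
  (sT : ∀ P : B12.RunParams, SeqOfRecord F ν M (gT P) P.K (lam.kSel P + 1)) (NmT : B12.RunParams → ℕ) (p₁ : ℕ)

/-- The layer's letters at run `P` (`rfl`): the §6 display's `D`. [cite: Balaban1989LargeFieldI, (1.89) p.198 (bookkeeping)] -/
theorem pinD189ΛH_D189 (P : B12.RunParams) :
    (lam.pinD189ΛH ν A₁ M gT σT sT NmT p₁).D189 P = D189OfHist ν P (sitOfHist ν A₁ M (NmT P) P (((((σT P).pinLambda (sT P) (N0OfSeq (F.P P.K).L ν.r (gT P) (lam.kSel P + 1)) (enlD F ν M P (gT P))).pinDistAt (lam.kSel P + 1)).pinZpp (sT P) (N0OfSeq (F.P P.K).L ν.r (gT P) (lam.kSel P + 1)) (NmT P) (enlD F ν M P (gT P))).pinCubes (((((σT P).pinLambda (sT P) (N0OfSeq (F.P P.K).L ν.r (gT P) (lam.kSel P + 1)) (enlD F ν M P (gT P))).pinDistAt (lam.kSel P + 1)).pinZpp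 (sT P) (N0OfSeq (F.P P.K).L ν.r (gT P) (lam.kSel P + 1)) (NmT P) (enlD F ν M P (gT P))).OmTᶜ ∩ omegaOfChain (sT P) (lam.kSel P + 1 - NmT P))) (gT P) (sT P) (N0OfSeq (F.P P.K).L ν.r (gT P) (lam.kSel P + 1)) p₁) (gT P) := rfl

/-- `kSel`, the Proposition-1 carrier and the (1.100) data are kept; the layer commutes with module 14 §1's (1.100) pin at Record 13; its levels are `k = kSel P + 1`, `h = k − N P`,
`k₀ = k − N₀ P` (`rfl` ×7). [cite: Balaban1989LargeFieldI, p.177, p.178, p.181, (1.100) p.201 (bookkeeping)] -/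
theorem pinD189ΛH_faces (θ : Stage13Params F N) (P : B12.RunParams) :
    (lam.pinD189ΛH ν A₁ M gT σT sT NmT p₁).kSel = lam.kSel ∧ (lam.pinD189ΛH ν A₁ M gT σT sT NmT p₁).LF = lam.LF ∧ (lam.pinD189ΛH ν A₁ M gT σT sT NmT p₁).D1100 = lam.D1100 ∧
    (lam.pinD189ΛH ν A₁ M gT σT sT NmT p₁).pinRPrime₁₃ θ = (lam.pinRPrime₁₃ θ).pinD189ΛH ν A₁ M gT σT sT NmT p₁ ∧
    ((lam.pinD189ΛH ν A₁ M gT σT sT NmT p₁).D189 P).k = lam.kSel P + 1 ∧ ((lam.pinD189ΛH ν A₁ M gT σT sT NmT p₁).D189 P).h = lam.kSel P + 1 - NmT P ∧ ((lam.pinD189ΛH ν A₁ M gT σT sT NmT p₁).D189 P).k₀ = lam.kSel P + 1 - (N0OfSeq (F.P P.K).L ν.r (gT P) (lam.kSel P + 1)) :=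
  ⟨rfl, rfl, rfl, rfl, rfl, rfl, rfl⟩

/-- The layer's `dist` at run `P` IS `dist(·, Λ)` of record at `k = kSel P + 1` for the PINNED `Λ = (Ω^{∼4}_{k₀+1})ᶜ ∩ Z` over the enlargement of record (`rfl`).
[cite: Balaban1989LargeFieldI, (1.73) p.192, (1.80) p.195 (bookkeeping)] -/
theorem pinD189ΛH_dist (P : B12.RunParams) :
    ((lam.pinD189ΛH ν A₁ M gT σT sT NmT p₁).D189 P).dist = distOfRecord (((enlD F ν M P (gT P)) 4 (lam.kSel P + 1 + 1 - (N0OfSeq (F.P P.K).L ν.r (gT P) (lam.kSel P + 1))) (omegaOfChain (sT P) (lam.kSel P + 1 + 1 - (N0OfSeq (F.P P.K).L ν.r (gT P) (lam.kSel P + 1)))))ᶜ ∩ (σT P).Z) (lam.kSel P + 1) :=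
  rfl

variable {lam ν A₁ M gT σT sT NmT p₁}

/-- ★★ **dag-n12-d's `h189` SLOT AT THE `Λ`-PINNED LAYER FROM ITS `h180` SLOT — NO LOCATED-GEOMETRY BINDER** (module 13's `h189_pinD189Z_of_h180_of_flow` shape, window-free): for
`D := (λ.pinD189ΛH …).D189 P`, `Claim189 (new189 D) (chiPP D)` from the (1.80) display (`h180`), the four ℍ-leaves, the levels `1 < (log g⁻²)^r`, `N₀(P) ≤ N P`, `N₀(P) ≤ kSel P + 1`, the
residual numerics and signs, `0 < σ.sh`, `0 < M`, print's two p. 200 conditions, the flow inputs, one step of monotone couplings, and `Λ ≠ ∅` — §6's `claim189_sitOfHist_Λ_of_flow` at `rfl`.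
[cite: Balaban1989LargeFieldI, (1.89) p.198, (1.73) p.192, pp.199–200, (1.80) p.195; Balaban1988Convergent, (2.1) p.254, (2.5)–(2.8) pp.255–256] -/
theorem h189_pinD189ΛH_of_h180_of_flow (P : B12.RunParams) (hsh : 0 < (σT P).sh) (hM : 0 < M)
    (hlog : 1 < (Real.log (gT P (lam.kSel P + 1) ^ 2)⁻¹) ^ ν.r) (hNN : (N0OfSeq (F.P P.K).L ν.r (gT P) (lam.kSel P + 1)) ≤ NmT P) (hNk : (N0OfSeq (F.P P.K).L ν.r (gT P) (lam.kSel P + 1)) ≤ lam.kSel P + 1)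
    (hβ0 : 0 ≤ (σT P).β) (hβ : (σT P).β ≤ 1 / 4) (hL₀ : 2 ≤ (σT P).L₀) (hL₀L : (σT P).L₀ ^ 2 ≤ ((F.P P.K).L : ℝ))
    (hB : 0 ≤ (σT P).O1 * (σT P).B₃ * (σT P).B₅) (hδ : 0 ≤ (σT P).δ)
    (hN₀ : (2 + (121 / 120) ^ 2 * ((σT P).O1 * (σT P).B₃ * (σT P).B₅ * (M : ℝ) ^ 5)) * (((σT P).L₀ ^ 2) ^ ((N0OfSeq (F.P P.K).L ν.r (gT P) (lam.kSel P + 1)) - 1))⁻¹ ≤ 1 / 4)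
    (hMl : (121 / 120) ^ 2 * ((σT P).O1 * (σT P).B₃ * (σT P).B₅ * (M : ℝ) ^ 5) * Real.exp (-(4 * (σT P).δ * (M : ℝ))) ≤ 1 / 12)
    (hε0 : ∀ i, lam.kSel P + 1 - NmT P ≤ i → i ≤ lam.kSel P + 1 → 0 ≤ epsOfRecord ν (gT P) i)
    (hε1 : ∀ i, lam.kSel P + 1 - NmT P ≤ i → i ≤ lam.kSel P + 1 → epsOfRecord ν (gT P) i ≤ 1 / 10)
    {β₀ : ℝ} (hβ₀0 : 0 ≤ β₀) (hβ₀ : β₀ ≤ 1 / 2)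
    (hflow : ∀ j, lam.kSel P + 1 - NmT P ≤ j → j < lam.kSel P + 1 →
      epsOfRecord ν (gT P) (lam.kSel P + 1) ≤ (1 + β₀) * Real.sqrt ((lam.kSel P + 1 - j : ℕ) : ℝ) * epsOfRecord ν (gT P) j)
    (hgpos : 0 < gT P (lam.kSel P + 1 + 1 - (N0OfSeq (F.P P.K).L ν.r (gT P) (lam.kSel P + 1)))) (hgstep : gT P (lam.kSel P + 1 + 1 - (N0OfSeq (F.P P.K).L ν.r (gT P) (lam.kSel P + 1))) ≤ gT P (lam.kSel P + 1 + 2 - (N0OfSeq (F.P P.K).L ν.r (gT P) (lam.kSel P + 1))))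
    (hgle : gT P (lam.kSel P + 1 + 2 - (N0OfSeq (F.P P.K).L ν.r (gT P) (lam.kSel P + 1))) ≤ 1)
    (hΛ : (((enlD F ν M P (gT P)) 4 (lam.kSel P + 1 + 1 - (N0OfSeq (F.P P.K).L ν.r (gT P) (lam.kSel P + 1))) (omegaOfChain (sT P) (lam.kSel P + 1 + 1 - (N0OfSeq (F.P P.K).L ν.r (gT P) (lam.kSel P + 1)))))ᶜ ∩ (σT P).Z).Nonempty)
    (L91h : ∀ U, new189 ((lam.pinD189ΛH ν A₁ M gT σT sT NmT p₁).D189 P) U → ∀ p ∈ plaqsOf (half ((lam.pinD189ΛH ν A₁ M gT σT sT NmT p₁).D189 P)),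
      Ineq191 (dist1 (plaqHol (((lam.pinD189ΛH ν A₁ M gT σT sT NmT p₁).D189 P).Upp U) p)) (((lam.pinD189ΛH ν A₁ M gT σT sT NmT p₁).D189 P).devV'' U p) ((lam.pinD189ΛH ν A₁ M gT σT sT NmT p₁).D189 P).α ((((lam.pinD189ΛH ν A₁ M gT σT sT NmT p₁).D189 P).L ^ ((lam.pinD189ΛH ν A₁ M gT σT sT NmT p₁).D189 P).h)⁻¹) (((lam.pinD189ΛH ν A₁ M gT σT sT NmT p₁).D189 P).ε ((lam.pinD189ΛH ν A₁ M gT σT sT NmT p₁).D189 P).h) (E124 ((lam.pinD189ΛH ν A₁ M gT σT sT NmT p₁).D189 P).ε ((lam.pinD189ΛH ν A₁ M gT σT sT NmT p₁).D189 P).L ((lam.pinD189ΛH ν A₁ M gT σT sT NmT p₁).D189 P).η ((lam.pinD189ΛH ν A₁ M gT σT sT NmT p₁).D189 P).k ((lam.pinD189ΛH ν A₁ M gT σT sT NmT p₁).D189 P).h))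
    (L95 : ∀ U, new189 ((lam.pinD189ΛH ν A₁ M gT σT sT NmT p₁).D189 P) U → ∀ p ∈ plaqsOf (half ((lam.pinD189ΛH ν A₁ M gT σT sT NmT p₁).D189 P)),
      Ineq195 (((lam.pinD189ΛH ν A₁ M gT σT sT NmT p₁).D189 P).devV'' U p) (dist1 (plaqHol (((lam.pinD189ΛH ν A₁ M gT σT sT NmT p₁).D189 P).Uhalf U (((lam.pinD189ΛH ν A₁ M gT σT sT NmT p₁).D189 P).boxOf p)) p)) ((lam.pinD189ΛH ν A₁ M gT σT sT NmT p₁).D189 P).α ((((lam.pinD189ΛH ν A₁ M gT σT sT NmT p₁).D189 P).L ^ ((lam.pinD189ΛH ν A₁ M gT σT sT NmT p₁).D189 P).h)⁻¹) (((lam.pinD189ΛH ν A₁ M gT σT sT NmT p₁).D189 P).ε ((lam.pinD189ΛH ν A₁ M gT σT sT NmT p₁).D189 P).h) (E124 ((lam.pinD189ΛH ν A₁ M gT σT sT NmT p₁).D189 P).ε ((lam.pinD189ΛH ν A₁ M gT σT sT NmT p₁).D189 P).L ((lam.pinD189ΛH ν A₁ M gT σT sT NmT p₁).D189 P).η ((lam.pinD189ΛH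 ν A₁ M gT σT sT NmT p₁).D189 P).k ((lam.pinD189ΛH ν A₁ M gT σT sT NmT p₁).D189 P).h))
    (L91 : ∀ U, new189 ((lam.pinD189ΛH ν A₁ M gT σT sT NmT p₁).D189 P) U → ∀ j, ((lam.pinD189ΛH ν A₁ M gT σT sT NmT p₁).D189 P).h ≤ j → j ≤ ((lam.pinD189ΛH ν A₁ M gT σT sT NmT p₁).D189 P).k → ∀ p ∈ plaqsOf (dom ((lam.pinD189ΛH ν A₁ M gT σT sT NmT p₁).D189 P) j),
      Ineq191 (dist1 (plaqHol (((lam.pinD189ΛH ν A₁ M gT σT sT NmT p₁).D189 P).Upp U) p)) (((lam.pinD189ΛH ν A₁ M gT σT sT NmT p₁).D189 P).dev97 U p) ((lam.pinD189ΛH ν A₁ M gT σT sT NmT p₁).D189 P).α ((((lam.pinD189ΛH ν A₁ M gT σT sT NmT p₁).D189 P).L ^ j)⁻¹) (((lam.pinD189ΛH ν A₁ M gT σT sT NmT p₁).D189 P).ε j) (E124 ((lam.pinD189ΛH ν A₁ M gT σT sT NmT p₁).D189 P).ε ((lam.pinD189ΛH ν A₁ M gT σT sT NmT p₁).D189 P).L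 ((lam.pinD189ΛH ν A₁ M gT σT sT NmT p₁).D189 P).η ((lam.pinD189ΛH ν A₁ M gT σT sT NmT p₁).D189 P).k j))
    (L97 : ∀ U, new189 ((lam.pinD189ΛH ν A₁ M gT σT sT NmT p₁).D189 P) U → ∀ j, ((lam.pinD189ΛH ν A₁ M gT σT sT NmT p₁).D189 P).h ≤ j → j ≤ ((lam.pinD189ΛH ν A₁ M gT σT sT NmT p₁).D189 P).k → ∀ p ∈ plaqsOf (dom ((lam.pinD189ΛH ν A₁ M gT σT sT NmT p₁).D189 P) j),
      Ineq191 (((lam.pinD189ΛH ν A₁ M gT σT sT NmT p₁).D189 P).dev97 U p) (((lam.pinD189ΛH ν A₁ M gT σT sT NmT p₁).D189 P).dev0 U p) ((lam.pinD189ΛH ν A₁ M gT σT sT NmT p₁).D189 P).α ((((lam.pinD189ΛH ν A₁ M gT σT sT NmT p₁).D189 P).L ^ j)⁻¹) (((lam.pinD189ΛH ν A₁ M gT σT sT NmT p₁).D189 P).ε j) (E124 ((lam.pinD189ΛH ν A₁ M gT σT sT NmT p₁).D189 P).ε ((lam.pinD189ΛH ν A₁ M gT σT sT NmT p₁).D189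 P).L ((lam.pinD189ΛH ν A₁ M gT σT sT NmT p₁).D189 P).η ((lam.pinD189ΛH ν A₁ M gT σT sT NmT p₁).D189 P).k j))
    (h180 : ∀ U, new189 ((lam.pinD189ΛH ν A₁ M gT σT sT NmT p₁).D189 P) U → ∀ j, ((lam.pinD189ΛH ν A₁ M gT σT sT NmT p₁).D189 P).h ≤ j → j ≤ ((lam.pinD189ΛH ν A₁ M gT σT sT NmT p₁).D189 P).k → ∀ q ∈ plaqsOf (dom ((lam.pinD189ΛH ν A₁ M gT σT sT NmT p₁).D189 P) j),
      Ineq180 (((lam.pinD189ΛH ν A₁ M gT σT sT NmT p₁).D189 P).dev0 U q) (((lam.pinD189ΛH ν A₁ M gT σT sT NmT p₁).D189 P).ε ((lam.pinD189ΛH ν A₁ M gT σT sT NmT p₁).D189 P).k) ((lam.pinD189ΛH ν A₁ M gT σT sT NmT p₁).D189 P).η ((lam.pinD189ΛH ν A₁ M gT σT sT NmT p₁).D189 P).B₃ ((lam.pinD189ΛH ν A₁ M gT σT sT NmT p₁).D189 P).B₅ ((lam.pinD189ΛH ν A₁ M gT σT sT NmT p₁).D189 P).M ((lam.pinD189ΛH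 ν A₁ M gT σT sT NmT p₁).D189 P).δ (((lam.pinD189ΛH ν A₁ M gT σT sT NmT p₁).D189 P).dist q) ((lam.pinD189ΛH ν A₁ M gT σT sT NmT p₁).D189 P).O1) :
    Claim189 (new189 ((lam.pinD189ΛH ν A₁ M gT σT sT NmT p₁).D189 P)) (chiPP ((lam.pinD189ΛH ν A₁ M gT σT sT NmT p₁).D189 P)) :=
  claim189_sitOfHist_Λ_of_flow (NmT P) P (σT P) (sT P) p₁ hsh hM rfl hlog hNN hNk hβ0 hβ hL₀ hL₀L hB hδ hN₀ hMl hε0 hε1 hβ₀0 hβ₀ hflow hgpos hgstep hgle hΛ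
    L91h L95 L91 L97 h180

/-- ★★ **… AND AT RECORD 13, IN THE RUN'S (2.7)-SMALL WINDOW** (module 14 §7's token shape; `N₀(P) := N0OfRecord₁₃ θ P (kSel P + 1)` is the layer's `N₀` by `rfl`): dag-n12-d's `h189` slot at
`λ.pinD189ΛH θ.ν θ.A₁ θ.τ9.M (gOfRecord₁₃ θ) σ s N p₁` from its `h180` slot, the four ℍ-leaves, `r ≥ 1`, `N₀(P) ≤ N P`, `N₀(P) ≤ kSel P + 1`, residual numerics ∕ signs, `0 < σ.sh`, `0 < M`,
ONE threshold `hwin`, `β₁₃ ≥ 0` along the history, print's second condition, the window (`S`, `hI`, `hup`, `hε10`, `hA₀`) and `Λ ≠ ∅` — NO located geometry.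
[cite: Balaban1989LargeFieldI, (1.89) p.198, (1.73) p.192, pp.199–200; Balaban1988Convergent, (2.1) p.254, (2.4)–(2.8) pp.255–256; Balaban1987RG1, (0.20) p.256, §1 p.264] -/
theorem h189_pinD189ΛH₁₃_of_h180_of_inInterval {θ : Stage13Params F N} {σT : ∀ P : B12.RunParams, Sit189 F N P.K}
    {sT : ∀ P : B12.RunParams, SeqOfRecord F θ.ν θ.τ9.M (gOfRecord₁₃ F N θ P) P.K (lam.kSel P + 1)} {NmT : B12.RunParams → ℕ} {p₁ : ℕ}
    (P : B12.RunParams) (hsh : 0 < (σT P).sh) (hM : 0 < θ.τ9.M)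
    (hr : 1 ≤ θ.ν.r) (hNN : (N0OfRecord₁₃ θ P (lam.kSel P + 1)) ≤ NmT P) (hNk : (N0OfRecord₁₃ θ P (lam.kSel P + 1)) ≤ lam.kSel P + 1)
    (hβ0 : 0 ≤ (σT P).β) (hβ : (σT P).β ≤ 1 / 4) (hL₀ : 2 ≤ (σT P).L₀) (hL₀L : (σT P).L₀ ^ 2 ≤ ((F.P P.K).L : ℝ))
    (hB : 0 ≤ (σT P).O1 * (σT P).B₃ * (σT P).B₅) (hδ : 0 ≤ (σT P).δ)
    (hwin : 4 * (2 + (121 / 120) ^ 2 * ((σT P).O1 * (σT P).B₃ * (σT P).B₅ * (θ.τ9.M : ℝ) ^ 5))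
      ≤ ((Real.log ((gOfRecord₁₃ F N θ P) (lam.kSel P + 1) ^ 2)⁻¹) ^ θ.ν.r) ^ (Real.log ((σT P).L₀ ^ 2) / Real.log ((F.P P.K).L : ℝ)))
    (hβhist : ∀ j, j < lam.kSel P + 1 → 0 ≤ betaOfRecord₁₃ F N θ j (prefixOf (gOfRecord₁₃ F N θ P) j))
    (hMl : (121 / 120) ^ 2 * ((σT P).O1 * (σT P).B₃ * (σT P).B₅ * (θ.τ9.M : ℝ) ^ 5) * Real.exp (-(4 * (σT P).δ * (θ.τ9.M : ℝ))) ≤ 1 / 12)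
    (hA₀ : 0 ≤ θ.ν.A₀) {β' β₀ : ℝ} {L : ℕ} (S : SmallnessFor θ.γ β' β₀ L θ.ν.p₀) (hβ₀ : β₀ ≤ 1 / 2) (hε10 : θ.γ * p0Profile θ.ν.A₀ θ.ν.p₀ θ.γ ≤ 1 / 10)
    (hI : Step.InInterval θ.γ (lam.kSel P + 1) (gOfRecord₁₃ F N θ P)) (hup : BetaUpperH β' θ.γ (betaOfRecord₁₃ F N θ))
    (hΛ : (((enlD F θ.ν θ.τ9.M P (gOfRecord₁₃ F N θ P)) 4 (lam.kSel P + 1 + 1 - (N0OfRecord₁₃ θ P (lam.kSel P + 1))) (omegaOfChain (sT P) (lam.kSel P + 1 + 1 - (N0OfRecord₁₃ θ P (lam.kSel P + 1)))))ᶜ ∩ (σT P).Z).Nonempty)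
    (L91h : ∀ U, new189 ((lam.pinD189ΛH θ.ν θ.A₁ θ.τ9.M (gOfRecord₁₃ F N θ) σT sT NmT p₁).D189 P) U → ∀ p ∈ plaqsOf (half ((lam.pinD189ΛH θ.ν θ.A₁ θ.τ9.M (gOfRecord₁₃ F N θ) σT sT NmT p₁).D189 P)),
      Ineq191 (dist1 (plaqHol (((lam.pinD189ΛH θ.ν θ.A₁ θ.τ9.M (gOfRecord₁₃ F N θ) σT sT NmT p₁).D189 P).Upp U) p)) (((lam.pinD189ΛH θ.ν θ.A₁ θ.τ9.M (gOfRecord₁₃ F N θ) σT sT NmT p₁).D189 P).devV'' U p) ((lam.pinD189ΛH θ.ν θ.A₁ θ.τ9.M (gOfRecord₁₃ F N θ) σT sT NmT p₁).D189 P).α ((((lam.pinD189ΛH θ.ν θ.A₁ θ.τ9.M (gOfRecord₁₃ F N θ) σT sT NmT p₁).D189 P).L ^ ((lam.pinD189ΛH θ.ν θ.A₁ θ.τ9.M (gOfRecord₁₃ F N θ) σT sT NmT p₁).D189 P).h)⁻¹) (((lam.pinD189ΛH θ.ν θ.A₁ θ.τ9.M (gOfRecord₁₃ F N θ) σT sT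 NmT p₁).D189 P).ε ((lam.pinD189ΛH θ.ν θ.A₁ θ.τ9.M (gOfRecord₁₃ F N θ) σT sT NmT p₁).D189 P).h) (E124 ((lam.pinD189ΛH θ.ν θ.A₁ θ.τ9.M (gOfRecord₁₃ F N θ) σT sT NmT p₁).D189 P).ε ((lam.pinD189ΛH θ.ν θ.A₁ θ.τ9.M (gOfRecord₁₃ F N θ) σT sT NmT p₁).D189 P).L ((lam.pinD189ΛH θ.ν θ.A₁ θ.τ9.M (gOfRecord₁₃ F N θ) σT sT NmT p₁).D189 P).η ((lam.pinD189ΛH θ.ν θ.A₁ θ.τ9.M (gOfRecord₁₃ F N θ) σT sT NmT p₁).D189 P).k ((lam.pinD189ΛH θ.ν θ.A₁ θ.τ9.M (gOfRecord₁₃ F N θ) σT sT NmT p₁).D189 P).h))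
    (L95 : ∀ U, new189 ((lam.pinD189ΛH θ.ν θ.A₁ θ.τ9.M (gOfRecord₁₃ F N θ) σT sT NmT p₁).D189 P) U → ∀ p ∈ plaqsOf (half ((lam.pinD189ΛH θ.ν θ.A₁ θ.τ9.M (gOfRecord₁₃ F N θ) σT sT NmT p₁).D189 P)),
      Ineq195 (((lam.pinD189ΛH θ.ν θ.A₁ θ.τ9.M (gOfRecord₁₃ F N θ) σT sT NmT p₁).D189 P).devV'' U p) (dist1 (plaqHol (((lam.pinD189ΛH θ.ν θ.A₁ θ.τ9.M (gOfRecord₁₃ F N θ) σT sT NmT p₁).D189 P).Uhalf U (((lam.pinD189ΛH θ.ν θ.A₁ θ.τ9.M (gOfRecord₁₃ F N θ) σT sT NmT p₁).D189 P).boxOf p)) p)) ((lam.pinD189ΛH θ.ν θ.A₁ θ.τ9.M (gOfRecord₁₃ F N θ) σT sT NmT p₁).D189 P).α ((((lam.pinD189ΛH θ.ν θ.A₁ θ.τ9.M (gOfRecord₁₃ F N θ) σT sT NmT p₁).D189 P).L ^ ((lam.pinD189ΛH θ.ν θ.A₁ θ.τ9.M (gOfRecord₁₃ F N θ) σT sT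 NmT p₁).D189 P).h)⁻¹) (((lam.pinD189ΛH θ.ν θ.A₁ θ.τ9.M (gOfRecord₁₃ F N θ) σT sT NmT p₁).D189 P).ε ((lam.pinD189ΛH θ.ν θ.A₁ θ.τ9.M (gOfRecord₁₃ F N θ) σT sT NmT p₁).D189 P).h) (E124 ((lam.pinD189ΛH θ.ν θ.A₁ θ.τ9.M (gOfRecord₁₃ F N θ) σT sT NmT p₁).D189 P).ε ((lam.pinD189ΛH θ.ν θ.A₁ θ.τ9.M (gOfRecord₁₃ F N θ) σT sT NmT p₁).D189 P).L ((lam.pinD189ΛH θ.ν θ.A₁ θ.τ9.M (gOfRecord₁₃ F N θ) σT sT NmT p₁).D189 P).η ((lam.pinD189ΛH θ.ν θ.A₁ θ.τ9.M (gOfRecord₁₃ F N θ) σT sT NmT p₁).D189 P).k ((lam.pinD189ΛH θ.ν θ.A₁ θ.τ9.M (gOfRecord₁₃ F N θ) σT sT NmT p₁).D189 P).h))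
    (L91 : ∀ U, new189 ((lam.pinD189ΛH θ.ν θ.A₁ θ.τ9.M (gOfRecord₁₃ F N θ) σT sT NmT p₁).D189 P) U → ∀ j, ((lam.pinD189ΛH θ.ν θ.A₁ θ.τ9.M (gOfRecord₁₃ F N θ) σT sT NmT p₁).D189 P).h ≤ j → j ≤ ((lam.pinD189ΛH θ.ν θ.A₁ θ.τ9.M (gOfRecord₁₃ F N θ) σT sT NmT p₁).D189 P).k → ∀ p ∈ plaqsOf (dom ((lam.pinD189ΛH θ.ν θ.A₁ θ.τ9.M (gOfRecord₁₃ F N θ) σT sT NmT p₁).D189 P) j),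
      Ineq191 (dist1 (plaqHol (((lam.pinD189ΛH θ.ν θ.A₁ θ.τ9.M (gOfRecord₁₃ F N θ) σT sT NmT p₁).D189 P).Upp U) p)) (((lam.pinD189ΛH θ.ν θ.A₁ θ.τ9.M (gOfRecord₁₃ F N θ) σT sT NmT p₁).D189 P).dev97 U p) ((lam.pinD189ΛH θ.ν θ.A₁ θ.τ9.M (gOfRecord₁₃ F N θ) σT sT NmT p₁).D189 P).α ((((lam.pinD189ΛH θ.ν θ.A₁ θ.τ9.M (gOfRecord₁₃ F N θ) σT sT NmT p₁).D189 P).L ^ j)⁻¹) (((lam.pinD189ΛH θ.ν θ.A₁ θ.τ9.M (gOfRecord₁₃ F N θ) σT sT NmT p₁).D189 P).ε j) (E124 ((lam.pinD189ΛH θ.ν θ.A₁ θ.τ9.M (gOfRecord₁₃ F N θ) σT sT NmT p₁).D189 P).ε ((lam.pinD189ΛH θ.ν θ.A₁ θ.τ9.M (gOfRecord₁₃ F N θ) σT sT NmT p₁).D189 P).L ((lam.pinD189ΛH θ.ν θ.A₁ θ.τ9.M (gOfRecord₁₃ F N θ) σT sT NmT p₁).D189 P).η ((lam.pinD189ΛH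 θ.ν θ.A₁ θ.τ9.M (gOfRecord₁₃ F N θ) σT sT NmT p₁).D189 P).k j))
    (L97 : ∀ U, new189 ((lam.pinD189ΛH θ.ν θ.A₁ θ.τ9.M (gOfRecord₁₃ F N θ) σT sT NmT p₁).D189 P) U → ∀ j, ((lam.pinD189ΛH θ.ν θ.A₁ θ.τ9.M (gOfRecord₁₃ F N θ) σT sT NmT p₁).D189 P).h ≤ j → j ≤ ((lam.pinD189ΛH θ.ν θ.A₁ θ.τ9.M (gOfRecord₁₃ F N θ) σT sT NmT p₁).D189 P).k → ∀ p ∈ plaqsOf (dom ((lam.pinD189ΛH θ.ν θ.A₁ θ.τ9.M (gOfRecord₁₃ F N θ) σT sT NmT p₁).D189 P) j),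
      Ineq191 (((lam.pinD189ΛH θ.ν θ.A₁ θ.τ9.M (gOfRecord₁₃ F N θ) σT sT NmT p₁).D189 P).dev97 U p) (((lam.pinD189ΛH θ.ν θ.A₁ θ.τ9.M (gOfRecord₁₃ F N θ) σT sT NmT p₁).D189 P).dev0 U p) ((lam.pinD189ΛH θ.ν θ.A₁ θ.τ9.M (gOfRecord₁₃ F N θ) σT sT NmT p₁).D189 P).α ((((lam.pinD189ΛH θ.ν θ.A₁ θ.τ9.M (gOfRecord₁₃ F N θ) σT sT NmT p₁).D189 P).L ^ j)⁻¹) (((lam.pinD189ΛH θ.ν θ.A₁ θ.τ9.M (gOfRecord₁₃ F N θ) σT sT NmT p₁).D189 P).ε j) (E124 ((lam.pinD189ΛH θ.ν θ.A₁ θ.τ9.M (gOfRecord₁₃ F N θ) σT sT NmT p₁).D189 P).ε ((lam.pinD189ΛH θ.ν θ.A₁ θ.τ9.M (gOfRecord₁₃ F N θ) σT sT NmT p₁).D189 P).L ((lam.pinD189ΛH θ.ν θ.A₁ θ.τ9.M (gOfRecord₁₃ F N θ) σT sT NmT p₁).D189 P).η ((lam.pinD189ΛH θ.ν θ.A₁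 θ.τ9.M (gOfRecord₁₃ F N θ) σT sT NmT p₁).D189 P).k j))
    (h180 : ∀ U, new189 ((lam.pinD189ΛH θ.ν θ.A₁ θ.τ9.M (gOfRecord₁₃ F N θ) σT sT NmT p₁).D189 P) U → ∀ j, ((lam.pinD189ΛH θ.ν θ.A₁ θ.τ9.M (gOfRecord₁₃ F N θ) σT sT NmT p₁).D189 P).h ≤ j → j ≤ ((lam.pinD189ΛH θ.ν θ.A₁ θ.τ9.M (gOfRecord₁₃ F N θ) σT sT NmT p₁).D189 P).k → ∀ q ∈ plaqsOf (dom ((lam.pinD189ΛH θ.ν θ.A₁ θ.τ9.M (gOfRecord₁₃ F N θ) σT sT NmT p₁).D189 P) j),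
      Ineq180 (((lam.pinD189ΛH θ.ν θ.A₁ θ.τ9.M (gOfRecord₁₃ F N θ) σT sT NmT p₁).D189 P).dev0 U q) (((lam.pinD189ΛH θ.ν θ.A₁ θ.τ9.M (gOfRecord₁₃ F N θ) σT sT NmT p₁).D189 P).ε ((lam.pinD189ΛH θ.ν θ.A₁ θ.τ9.M (gOfRecord₁₃ F N θ) σT sT NmT p₁).D189 P).k) ((lam.pinD189ΛH θ.ν θ.A₁ θ.τ9.M (gOfRecord₁₃ F N θ) σT sT NmT p₁).D189 P).η ((lam.pinD189ΛH θ.ν θ.A₁ θ.τ9.M (gOfRecord₁₃ F N θ) σT sT NmT p₁).D189 P).B₃ ((lam.pinD189ΛH θ.ν θ.A₁ θ.τ9.M (gOfRecord₁₃ F N θ) σT sT NmT p₁).D189 P).B₅ ((lam.pinD189ΛH θ.ν θ.A₁ θ.τ9.M (gOfRecord₁₃ F N θ) σT sT NmT p₁).D189 P).M ((lam.pinD189ΛH θ.ν θ.A₁ θ.τ9.M (gOfRecord₁₃ F N θ) σT sT NmT p₁).D189 P).δ (((lam.pinD189ΛH θ.ν θ.A₁ θ.τ9.M (gOfRecord₁₃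 F N θ) σT sT NmT p₁).D189 P).dist q) ((lam.pinD189ΛH θ.ν θ.A₁ θ.τ9.M (gOfRecord₁₃ F N θ) σT sT NmT p₁).D189 P).O1) :
    Claim189 (new189 ((lam.pinD189ΛH θ.ν θ.A₁ θ.τ9.M (gOfRecord₁₃ F N θ) σT sT NmT p₁).D189 P)) (chiPP ((lam.pinD189ΛH θ.ν θ.A₁ θ.τ9.M (gOfRecord₁₃ F N θ) σT sT NmT p₁).D189 P)) :=
  claim189_sitOfHist₁₃_Λ_of_inInterval (NmT P) P (σT P) (sT P) p₁ hsh hM rfl hr hNN hNk hβ0 hβ hL₀ hL₀L hB hδ hwin hβhist hMl hA₀ S hβ₀ hε10 hI hup hΛ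
    L91h L95 L91 L97 h180

end Layer


/-! ## §10. (v1.1) «N sufficiently large» IN NUMBERS — the joint edge of the threshold and the memory inputs (referee ref-I NIT-I1 on module 12, in kernel) -/

section JointEdge

open B15Claim189N0OfRecord (N0OfSeq log_pow_le_pow_of_N0OfSeq_le pow_rpow_alpha0)

variable {L : ℕ} (r : ℕ) (g : ℕ → ℝ) (k : ℕ)

/-- **THE THRESHOLD `hwin` AND THE MEMORY BOUND `N₀ ≤ N` JOINTLY FORCE `4(2 + C) ≤ (L₀²)^{N−1}`** — print's *«N has to be sufficiently large»* (p. 198) in numbers: along a history with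
non-decreasing couplings in `]0, 1]` at the levels `k + 1 − N₀ ≤ k`, `hwin : 4(2 + C) ≤ ((log g_k⁻²)^r)^{α₀}` (`α₀ = log L₀² ∕ log L`, `L₀ ≥ 1`, `L ≥ 2`) and `N₀ ≤ N` give
`((log g_k⁻²)^r)^{α₀} ≤ (L^{N−1})^{α₀} = (L₀²)^{N−1}` (module 12 §5's lower edge + §2's exponent identity).  So at `C = (121∕120)²O(1)B₃B₅M⁵` a memory `N` serving the (1.89) route has
`(L₀²)^{N−1} ≥ 8 + 4C`. [cite: Balaban1989LargeFieldI, p.198 («N has to be sufficiently large»), p.200; Balaban1988Convergent, (2.5) p.255] -/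
theorem joint_edge_of_hwin_of_N0OfSeq_le (hL : 2 ≤ L) (hpos : 0 < g (k + 1 - N0OfSeq L r g k)) (hmono : g (k + 1 - N0OfSeq L r g k) ≤ g k) (hle : g k ≤ 1)
    {Nm : ℕ} (hNN : N0OfSeq L r g k ≤ Nm) {L₀ C : ℝ} (hL₀ : 1 ≤ L₀)
    (hwin : 4 * (2 + C) ≤ ((Real.log (g k ^ 2)⁻¹) ^ r) ^ (Real.log (L₀ ^ 2) / Real.log (L : ℝ))) :
    4 * (2 + C) ≤ (L₀ ^ 2) ^ (Nm - 1) := by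
  have hX := log_pow_le_pow_of_N0OfSeq_le r g k hL hpos hmono hle hNN
  have hgk : 0 < g k := lt_of_lt_of_le hpos hmono
  have hX0 : 0 ≤ (Real.log (g k ^ 2)⁻¹) ^ r := by
    apply pow_nonneg
    apply Real.log_nonneg
    exact one_le_inv_iff₀.mpr ⟨by positivity, by nlinarith⟩
  have hα : 0 ≤ Real.log (L₀ ^ 2) / Real.log (L : ℝ) :=
    div_nonneg (Real.log_nonneg (by nlinarith)) (Real.log_nonneg (by exact_mod_cast (by omega : 1 ≤ L)))
  have hL1 : (1 : ℝ) < (L : ℝ) := by exact_mod_cast (by omega : 1 < L)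
  have hmono' := Real.rpow_le_rpow hX0 hX hα
  rw [show (((L ^ (Nm - 1) : ℕ)) : ℝ) = (L : ℝ) ^ (Nm - 1) by push_cast; ring, pow_rpow_alpha0 hL1 (by linarith) (Nm - 1)] at hmono'
  exact hwin.trans hmono'

end JointEdge

end B15Claim189LambdaPin

end Literature.MathematicalPhysics.QuantumFieldTheory.Balaban1983to89

end
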